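import Summits.AtomisticToContinuum.HydrodynamicLimit.Theses.OneFlightGossipEngine
import Summits.AtomisticToContinuum.HydrodynamicLimit.Theses.WarmColdDichotomy
import Summits.AtomisticToContinuum.HydrodynamicLimit.Theorems.OneFlightGossipEngineEnergyCurrentTailsQuarticDocking
import Summits.AtomisticToContinuum.HydrodynamicLimit.Theorems.OneFlightGossipEngineEnergyCurrentTailsQuarticLedger
import Summits.AtomisticToContinuum.HydrodynamicLimit.Theorems.OneFlightGossipEngineEnergyCurrentTailsQuarticData
import Summits.AtomisticToContinuum.HydrodynamicLimit.Theorems.OneFlightGossipEngineEnergyCurrentTailsGainCeilingGlue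
import Summits.AtomisticToContinuum.HydrodynamicLimit.Theorems.OneFlightGossipEngineEnergyCurrentTailsEnergyFluxCeilingRung0
import Summits.AtomisticToContinuum.HydrodynamicLimit.Theses.JeansLoadedDice
import Summits.AtomisticToContinuum.HydrodynamicLimit.Theses.AprioriTailsRattlers
import Summits.AtomisticToContinuum.HydrodynamicLimit.Theorems.OneFlightGossipEngineEnergyCurrentTailsGainCeilingRung0
import Summits.AtomisticToContinuum.HydrodynamicLimit.Theorems.OneFlightGossipEngineEnergyCurrentTailsDocking
import Summits.AtomisticToContinuum.HydrodynamicLimit.Theorems.OneFlightGossipEngineEnergyCurrentTailsEquilibrium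
import Summits.AtomisticToContinuum.HydrodynamicLimit.Theorems.JParityClosureOddContactSymmetryGibbsInvariance
import Summits.AtomisticToContinuum.HydrodynamicLimit.Theorems.EnergyCurrentTails.Negative.CubicTailExpMoment
import Summits.AtomisticToContinuum.HydrodynamicLimit.Theorems.EnergyCurrentTails.Negative.FocusingLaws
import Summits.AtomisticToContinuum.HydrodynamicLimit.Theorems.EnergyCurrentTails.Negative.CollisionFocusing
import Summits.AtomisticToContinuum.HydrodynamicLimit.Theorems.OneFlightGossipEngineEnergyCurrentTailsWindowQuarticFloor
import Summits.AtomisticToContinuum.HydrodynamicLimit.Theorems.OneFlightGossipEngineEnergyCurrentTailsLossFloorGlue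
import Summits.AtomisticToContinuum.HydrodynamicLimit.Theorems.OneFlightGossipEngineEnergyCurrentTailsLossIntensityFloorGlue
import Summits.AtomisticToContinuum.HydrodynamicLimit.Theorems.OneFlightGossipEngineEnergyCurrentTailsLossIntensityFloorMixingGlue
import Summits.AtomisticToContinuum.HydrodynamicLimit.Theorems.OneFlightGossipEngineEnergyCurrentTailsMixingFloorRung0
import Summits.AtomisticToContinuum.HydrodynamicLimit.Theorems.OneFlightGossipEngineEnergyCurrentTailsWindowQuarticFloor4
import Summits.AtomisticToContinuum.HydrodynamicLimit.Theorems.OneFlightGossipEngineEnergyCurrentTailsLossIntensityFloor4MixingGlue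
import Summits.AtomisticToContinuum.HydrodynamicLimit.Theorems.OneFlightGossipEngineEnergyCurrentTailsLossFloorGlue4
import Summits.AtomisticToContinuum.HydrodynamicLimit.Theorems.OneFlightGossipEngineEnergyCurrentTailsMixingFloor4Rung0
import Summits.AtomisticToContinuum.HydrodynamicLimit.Theorems.OneFlightGossipEngineEnergyCurrentTailsEnergyFluxCeilingDock
import Summits.AtomisticToContinuum.HydrodynamicLimit.Theorems.OneFlightGossipEngineEnergyCurrentTailsEnergyFluxCeilingOneRareDock
import Summits.AtomisticToContinuum.HydrodynamicLimit.Theorems.OneFlightGossipEngineEnergyCurrentTailsSplitDeficitRung0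
import Summits.AtomisticToContinuum.HydrodynamicLimit.Theorems.OneFlightGossipEngineEnergyCurrentTailsRateFloorQuarticRung0
import Summits.AtomisticToContinuum.HydrodynamicLimit.Theorems.JParityClosureRateFloorLineDefs
import Summits.AtomisticToContinuum.HydrodynamicLimit.Theorems.OneFlightGossipEngineEnergyCurrentTailsFirstPartnerObjects
import Summits.AtomisticToContinuum.HydrodynamicLimit.Theorems.OneFlightGossipEngineEnergyCurrentTailsMixingFloor4LWeakening
import Summits.AtomisticToContinuum.HydrodynamicLimit.Theorems.OneFlightGossipEngineEnergyCurrentTailsLossIntensityFloor4LMixingGlue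
import Summits.AtomisticToContinuum.HydrodynamicLimit.Theorems.OneFlightGossipEngineEnergyCurrentTailsLossFloorGlue4L
import Summits.AtomisticToContinuum.HydrodynamicLimit.Theorems.OneFlightGossipEngineEnergyCurrentTailsSplitLagged
import Summits.AtomisticToContinuum.HydrodynamicLimit.Theorems.OneFlightGossipEngineEnergyCurrentTailsFirstPartnerPathwise
import Summits.AtomisticToContinuum.HydrodynamicLimit.Theorems.OneFlightGossipEngineEnergyCurrentTailsWindowRateFloorGlue
import Summits.AtomisticToContinuum.HydrodynamicLimit.Theorems.OneFlightGossipEngineEnergyCurrentTailsMixingFloor4LOffsetAveraging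
import Literature.Analysis.FluidPDE.HardSphereCollisionRecord
import HarnessLib

/-!
# Line `quartic-schur-ledger` for the crux `EnergyCurrentTails` (stmt-AtomisticToContinuum-9235)
# — registered skeleton (crux-plan round 1, planner v2; LEAD 1 cycle 2 END STATE: stub L LANDED p97111,
# Q0 LANDED p100638 (parallel seat c1-0), RESHAPE S2 := S2b(Q0, S2a) with S2b LANDED p102356; rung-0
# certificates LANDED for S2 (p98294) and S2a (p102898); OPEN: S1 `stub_lossFloor` (⟸ C⁺; held by the
# lead) and S2a `stub_energyFluxCeiling` (one-sided Stosszahlansatz for the bilinear mark under the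
# evolved law) — both crux-sized.  The `sorry`s of Q0 and S2b below are PLACEHOLDERS only until the farm
# builds their landed modules (then: import + name); §5 = sorry-free certificates.)
#
# SEAT c5 RESHAPE (lead prover-line-stmt-AtomisticToContinuum-9235-c5-0, 2026-08-17): seat a1 had docked
# S2a and the mixed Povzner term of S1 onto CID = stmt-9218 `ContactIntensityDomination`, which seat c4
# REFUTED (p129870, `stub_contactIntensityDomination_false` below).  CID and its glue are removed; the
# upper content is re-homed on the line's own BULK energy-flux ceiling S2a″ `stub_energyFluxCeilingWindows`
# (Euler-free, all windows; rung 0 = p102898, rung ½ = c4's audit), the lower content on RF₂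
# `stub_fastCollisionRateQuartic` (the p = 2 instance of `FastParticleCollisionRate`) ∧ SD
# `stub_quarticSplitDeficit`; LIF is re-typed as LIF′ `stub_lossIntensityFloor_of_rateSplitFlux :
# RF₂ → SD → S2a″ → LIF` with a1's conclusion verbatim, so the LANDED S1-glue (p126987) and WF (p126563)
# close S1; S2a := dock(S2a″).  OPEN after the reshape: RF₂, SD, S2a″ (crux-strength primitives) + the two
# provable glues LIF′, S2a-dock + two rung-0 audit stubs (SD, RF₂).
#
# SEAT c5 CYCLES 2–3 (2026-08-17T02–04Z): wave 1 LANDED all five provable stubs of the reshape (S2a-dock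
# p135409, S2a″⟸stmt-16939 dock p139311, LIF′ p136506→p140393, SD-rung0 p140148, RF₂-rung0 p135746).
# Cycle-2 RESHAPE of the lower primitive: RF₂ ∧ SD ⟶ ONE statement QMF `stub_quarticMixingFloor` (quartic
# mixing floor: lab-fast spheres collide at rate ≥ cν‖v‖ with a mixed outgoing split, ‖v‖⁴-weighted,
# time-integrated) with the glue LIF″ `stub_lossIntensityFloor_of_mixingFlux : QMF → S2a″ → LIF` (LANDED
# p140830, wave 2) and the audit stub `stub_quarticMixingFloorRung0`; RF₂/SD stay in the tree as the
# hypothesis types of the landed LIF′ (composition `…Theorems.QuarticSchurLedger.EnergyCurrentTails_of_subs`).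
# §3 `absorbing_recursion` LANDED p140837 and the §4 composition LANDED as
# `…Theorems.QuarticSchurLedger.EnergyCurrentTails_of_lossIntensityFloor / _of_subs / _of_mixingFloor`
# (file `…EnergyCurrentTailsSplit.lean`), so the crux is CLOSED MODULO exactly {S2a″, QMF}
# (equivalently {S2a″, RF₂, SD}); S2a″ has the typed producer stmt-16939 (dock landed).

Crux (route `OneFlightGossipEngine`, rank 9; the item's primary copy is the textually identical
`WarmColdDichotomy.EnergyCurrentTails`, rank 4; shared by BallwiseInvariantReferences, AnosovDiceHopf,
TwoClocks, JaynesSqueeze, PesinPricing, ExpTailStaging): for continuous profiles `a₀, θ₀ > 0`, `u₀`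
there is `σ₀ > 0` such that for `0 < σ < σ₀`, every classical hs-Euler solution on `[0,T)`, every
flow family `Φ N` and local Gibbs data `λ_N` whose fields converge at `t = 0`:
`∀ t < T ∀ ε > 0 ∃ M ∃ N₀ ∀ N ≥ N₀ ∀ s ∈ [0,t], E_{λ_N}[(N+1)⁻¹ ∑ᵢ 𝟙{M < |vᵢ(s)|}|vᵢ(s)|³] ≤ ε`.

## The lever (idea card `Ideas/quartic-schur-ledger.md`, merged by the triage panel with
## `Ideas/quartic-disparity-closure.md`)

AT `p = 2` POVZNER IS A SIGNED IDENTITY.  For one elastic collision with unit impact vector `ω`,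
`a = ⟪v,ω⟫`, `b = ⟪w,ω⟫`:
`Δ₄ := ‖v′‖⁴ + ‖w′‖⁴ − ‖v‖⁴ − ‖w‖⁴ = −2(a² − b²)((‖v‖² − a²) − (‖w‖² − b²))`
(`quartic_collision_identity`, PROVED, §0): non-positive exactly for EQUALISING collisions, and its
positive part is `≤ 2‖v‖²‖w‖²` for EVERY impact geometry (`quartic_collision_gain_le`, PROVED) —
bilinear in the two energies, never quartic in the fast partner (saturated by the complete transfer
`Disproof.reflectVel_focus`).  Hence ONE scalar, the expected empirical quartic moment
`y_N(s) = E_{λ_N}[(N+1)⁻¹ ∑ᵢ ‖vᵢ(s)‖⁴]`, obeys an EXACT LEDGER along the deterministic flow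
(stub L, `stub_quarticLedger`): `y(s′) + Loss(s,s′] = y(s) + Gain(s,s′]`, where `Gain`/`Loss` are the
expected normalised collision sums of `(Δ₄)±/2` over the tree's collision records
(`HardSphereFlow.collisionSum`, ordered pairs, hence the `1/2`).  Two ONE-SIDED, constant-factor,
in-expectation statements about the collisions of one bath mean-free-time window
`h_N = τ(N+1)^{-1/3}` then close it:

* S1 `stub_lossFloor` (crux-strength): `c·y(s) ≤ c·A + Loss(s, s+h_N]` — within the window the
  energetic particles (those carrying the quartic content above the level `A = (K₀Θ)²`) dissipate a
  fixed fraction `c` of it through δ-SPLITTING encounters (two-sided: neither grazing nor dead-centre);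
* S2 `stub_gainCeiling` (crux-strength): `Gain(s,s′] ≤ D(η) + η·sup_{[s,s′]} y` for EVERY `η > 0` —
  the gain is bilinear, so partners that are thermal ON AVERAGE give a window gain
  `≲ τσ²Θ(√Θ m₂ + m₃) ≤ D + η y` (`m₃ ≤ √(m₂ m₄)`, `m₂` conserved); only a DYNAMICAL over-production
  of fast–fast encounters at arbitrarily high levels (transient hot micro-clusters) can break it;

and the composition is the ABSORBING ONE-WINDOW RECURSION (`absorbing_recursion`, PROVED, §3):
`y((k+1)h) ≤ (1 − c/2) y(kh) + cA + 2D`, `sup_window y ≤ 2(y(kh) + D)`, whence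
`sup_{s ≤ t} y_N(s) ≤ 2(max(B, 2A + 4D/c) + D)` uniformly in `N ≥ N₀` — the collision clock
`ν_N = σ²(N+1)^{1/3} → ∞` has CANCELLED (both sides of the ledger count the same collisions; neither
`h_N` nor the number of windows `t/h_N → ∞` enters the bound), and after one window the bound no longer
remembers the initial quartic content except through `B` (stub Q0, `stub_quarticData`: the local
Gibbs datum has an `N`-uniform quartic moment, and a crude `N`-dependent bound along the flow by
energy conservation).  The uniform quartic moment is the card's transfer statement C⁺
(`QuarticMomentBound`; = the lead's single open stub `IdeatorThreeSketch.stub_quarticInfluence` read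
on the `λ_N` side), and C⁺ ⟹ crux is ALREADY LANDED (`…Theorems.LoschmidtTagging.stub_quarticDocking`,
p92098: Chebyshev `𝟙{M<|v|}|v|³ ≤ |v|⁴/M`, `M = |C|/ε + 1`), so no transfer stub is needed.

## Stubs registered here (6 after the lead's reshape; sorries ONLY in `Holds.stub_*`)

* L  `stub_quarticLedger` — the exact quartic ledger in expectation — CLOSED (lead 1 wave 1,
     `…Theorems.QuarticSchurLedger.stub_quarticLedger`, p97111: weak balance law with zero streaming
     term + `contactPairs_eq_pair` + `lintegral_add_left`).
* Q0 `stub_quarticData`   — quartic moment of the local Gibbs datum, `N`-uniform; crude finiteness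
     along the flow — CLOSED (`…Theorems.QuarticSchurLedger.stub_quarticData`, landed 12:07Z by the
     parallel lead seat …-9235-c1-0; this seat's proof work/stubs/stub_quarticData.lean, rc 0, is the
     same argument: s = 0 disintegration + `configEnergy_eq_holds` + Cauchy–Schwarz).
* S1 `stub_lossFloor`     — window LOSS FLOOR (crux-strength; the hardest; OPEN, held by the lead).
     §5: S1 ⟸ C⁺ (`lossFloor_of_quarticMomentBound`: A := C, Loss ≥ 0), so S1 cannot die unless C⁺
     dies; rung 0 (`quarticMoment_rung0_le`): holds at global equilibrium with `A = E‖w‖⁴`.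
* S2 `stub_gainCeiling`   — SUB-LINEAR (bilinear) window GAIN CEILING (crux-strength; OPEN).  Rung-0
     certificate LANDED (lead 1 wave 1, `…Theorems.QuarticSchurLedger.stub_gainCeilingRung0`, p98294:
     `Gain_N(s,s′] ≤ 16τσ²·∫‖w−v‖(‖v‖²+‖w‖²)²/4 dN⊗N` for ALL N ≥ 1 and all windows of length
     `≤ τ(N+1)^{-1/3}`, η-term unused — the N-scaling `(N+1)⁻¹·16h_N(N+1)²ε_N² = 16τσ²` is exact);
     §5 `gainCeiling_rung0_body`: the literal S2 body at constant profiles.  For the EVOLVED law no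
     tree tool bounds the energy-weighted collision flux (relative entropy / Liouville /
     `f ≤ K^{N+1}·Gibbs` lose `e^{Θ(N)}`; the quartic gain has no exponential moment).

* S2a `stub_energyFluxCeiling` (lead 1 reshape; OPEN, crux-strength) — the ENERGY-WEIGHTED
     PRE-COLLISIONAL FLUX CEILING: `E[(N+1)⁻¹Σ_coll ‖v₁⁻‖²‖v₂⁻‖²] ≤ K·σ²(N+1)^{1/3}(s′−s)·sup m₂·sup m₃`
     — S2's canonical open content (one-sided molecular chaos at contact for the one bilinear mark
     the gain lemma produces; the census line's F1 in mark form).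
* S2b `stub_gainCeiling_of_energyFluxCeiling` (lead 1 reshape; CLOSED p102356) — `Q0 → S2a → S2`:
     `(Δ₄)₊/2 ≤ ‖v₁⁻‖²‖v₂⁻‖²` by pair energy conservation, `m₂(r) = m₂(0) ≤ 1 + B`, pointwise AM–GM
     `‖v‖³ ≤ (λ‖v‖⁴ + ‖v‖²/λ)/2`, the clock `(N+1)^{1/3}(s′−s) ≤ τ`, and the choice
     `λ = 2η/((K+1)σ²τ(1+B))`, giving `D(η) = ((K+1)σ²τ)²(1+B)³/(4η)`.  `Holds.stub_gainCeiling` is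
     now DERIVED (`:= S2b Q0 S2a`), so the composition below is unchanged.

Composition (sorry-free): `quarticMomentBound_of : L → Q0 → S1 → S2 → QuarticMomentBound`,
`EnergyCurrentTails_of : L → Q0 → S1 → S2 → WarmColdDichotomy.EnergyCurrentTails` (the item's primary
decl, BY NAME), `EnergyCurrentTails_of_oneFlight` (the `OneFlightGossipEngine` copy, BY NAME), and the
hypothesis-free `EnergyCurrentTails_proof` (modulo the four stubs).

## Disproof honoured (`Cruxes/EnergyCurrentTails/Disproof.lean`, cycle 1; `EquilibriumRung.lean`)

* §3 `energyCurrentTails_false_without_randomness(_inDomain)` (H = randomness of the data): S1, S2, Q0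
  are EXPECTATIONS under `λ_N`; the only sure statement is the ledger L, an identity.  The witness
  `fastConfig` (one sphere at speed `√(N+1)`) has `y = N + 1`: admitted pathwise, excluded in
  expectation by Q0 at `s = 0` and by the recursion later, as it must be.
* §4 `energyCurrentTails_false_of_quadraticUI_only` (H = more than quadratic UI): the line transfers UP
  to `m₄` (Q0 is a fourth-moment statement, false for `twoPointLaw`, whose `m₄ ≍ (N+1)^{1/2}`).
* §5 `reflectVel_focus`, `focusing_tree`, `cubicTail_not_nonincreasing` (no pathwise maximum
  principle): nothing is claimed monotone pathwise — L carries the GAIN term explicitly, S2 prices the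
  focusing trees' expected weight, and `quartic_collision_gain_le` is saturated exactly by
  `reflectVel_focus` (`Δ₄ = +2a⁴`).
* §6 `energyCurrentTailsExpMoment_false` and the LANDED
  `…Theorems.EnergyCurrentTails.Negative.CubicTailExpMoment` (p82390; exponential currency dead at
  `t = 0` already): polynomial currency throughout — no stub is an instance of
  `EnergyCurrentTailsExpMoment`; the crux is consumed by Chebyshev (`stub_quarticDocking`), as §4(d)
  of the Disproof demands.
* The stub set is checked against ALL THREE landed negative files (`Negative.CubicTailExpMoment` p82390,
  imported; `Negative.FocusingLaws` p95055 and `Negative.CollisionFocusing` p95063, landed during this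
  session and not yet built on the farm — imports prepared above, commented): no stub is a sure
  statement (`EnergyCurrentTailsSure[InDomain]`), none follows from quadratic UI
  (`EnergyCurrentTailsOfQuadraticUI`), none claims pathwise monotonicity (`CubicTailNonincreasing`), none
  is an exponential moment (`EnergyCurrentTailsExpMoment`); and the gain lemma is SHARP exactly on the
  landed focusing collision (`quartic_gain_saturated_by_focus`, proved against `focus_collision`, a
  verbatim re-proof of `EnergyCurrentTailsNegative.reflectVel_focus`).
* USED POSITIVELY: `EquilibriumRung.energyCurrentTails_homogeneous` / the lead's landed
  `stub_equilibriumRung` is the `u₀ = 0`, constant-profile rung where `y(s) = y(0)` and S1/S2 hold with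
  `A ≥ y(0)`; `-- Targets` predicted: `stub_lossFloor` first (two-temperature slab, Disproof §7(i)).

References: Bobylev 1997, Mischler–Wennberg 1999 (Povzner with exact energy-split variables);
Bobylev–Gamba–Panferov 2004, Gamba–Panferov–Villani 2009, Alonso–Cañizo–Gamba–Mouhot 2013 (Boltzmann
moment/tail theory this replaces at `p = 2`); Mischler–Mouhot 2013 (uniform-in-`N` moments for the
stochastic `N`-particle hard-sphere process — the twin statement); Desvillettes 1993 / Wennberg 1997
(moment CREATION for hard potentials — the absorbing recursion is its `N`-body shadow);
Cercignani–Illner–Pulvirenti 1994 §6.2; Olla–Varadhan–Yau 1993 §1 and Nachtergaele–Yau 2003 §2.3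
(the barrier: the cut-off functional).
-/

noncomputable section

open MeasureTheory Set Filter
open scoped ENNReal InnerProductSpace

namespace Summit.AtomisticToContinuum.HydrodynamicLimit.Cruxes.EnergyCurrentTails.QuarticSchurLedger

open Literature.MathematicalPhysics.KineticTheory Literature.Analysis.FluidPDE

/-! ## §0 The signed quartic increment of one elastic collision (proved; for the S1/S2 provers)

The collision map is the tree's `Literature.Analysis.FluidPDE.reflectVel ω (v, w)`; `ω` is a unit
impact vector (re-proved from the ideator-1 sketch `Cruxes/EnergyCurrentTails/IdeatorOneSketch.lean`
§0–§1, rc 0 there and here). -/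

/-- Energy exchange (exact): `‖v′‖² = ‖v‖² − ⟪v,ω⟫² + ⟪w,ω⟫²` for a unit impact vector. [folklore] -/
theorem norm_sq_reflectVel_fst (v w ω : V3) (hω : ‖ω‖ = 1) :
    ‖(reflectVel ω (v, w)).1‖ ^ 2 = ‖v‖ ^ 2 - ⟪v, ω⟫_ℝ ^ 2 + ⟪w, ω⟫_ℝ ^ 2 := by
  have h1 : ‖ω‖ ^ 2 = 1 := by rw [hω]; norm_num
  have hc : ⟪v - w, ω⟫_ℝ = ⟪v, ω⟫_ℝ - ⟪w, ω⟫_ℝ := inner_sub_left _ _ _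
  simp only [reflectVel, h1, div_one]
  rw [norm_sub_sq_real, norm_smul, mul_pow, Real.norm_eq_abs, sq_abs, h1, inner_smul_right, hc]
  ring

/-- Energy exchange (exact): `‖w′‖² = ‖w‖² + ⟪v,ω⟫² − ⟪w,ω⟫²`. [folklore] -/
theorem norm_sq_reflectVel_snd (v w ω : V3) (hω : ‖ω‖ = 1) :
    ‖(reflectVel ω (v, w)).2‖ ^ 2 = ‖w‖ ^ 2 + ⟪v, ω⟫_ℝ ^ 2 - ⟪w, ω⟫_ℝ ^ 2 := by
  have h1 : ‖ω‖ ^ 2 = 1 := by rw [hω]; norm_num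
  have hc : ⟪v - w, ω⟫_ℝ = ⟪v, ω⟫_ℝ - ⟪w, ω⟫_ℝ := inner_sub_left _ _ _
  simp only [reflectVel, h1, div_one]
  rw [norm_add_sq_real, norm_smul, mul_pow, Real.norm_eq_abs, sq_abs, h1, inner_smul_right, hc]
  ring

/-- **At `p = 2` Povzner is a signed identity** (the lever).  For every elastic hard-sphere
collision with unit impact vector `ω`, `a = ⟪v,ω⟫`, `b = ⟪w,ω⟫` (energy passed from `v` to `w`:
`ΔE = a² − b²`):
`‖v′‖⁴ + ‖w′‖⁴ − ‖v‖⁴ − ‖w‖⁴ = −2 (a² − b²) ((‖v‖² − a²) − (‖w‖² − b²)) = −2·ΔE·(E₁′ − E₂)`,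
non-positive exactly when the collision is EQUALISING. [cite: Bobylev1997; MischlerWennberg1999] -/
theorem quartic_collision_identity (v w ω : V3) (hω : ‖ω‖ = 1) :
    ‖(reflectVel ω (v, w)).1‖ ^ 4 + ‖(reflectVel ω (v, w)).2‖ ^ 4 - ‖v‖ ^ 4 - ‖w‖ ^ 4
      = -2 * (⟪v, ω⟫_ℝ ^ 2 - ⟪w, ω⟫_ℝ ^ 2)
          * ((‖v‖ ^ 2 - ⟪v, ω⟫_ℝ ^ 2) - (‖w‖ ^ 2 - ⟪w, ω⟫_ℝ ^ 2)) := by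
  have e1 := norm_sq_reflectVel_fst v w ω hω
  have e2 := norm_sq_reflectVel_snd v w ω hω
  have p1 : ‖(reflectVel ω (v, w)).1‖ ^ 4 = (‖(reflectVel ω (v, w)).1‖ ^ 2) ^ 2 := by ring
  have p2 : ‖(reflectVel ω (v, w)).2‖ ^ 4 = (‖(reflectVel ω (v, w)).2‖ ^ 2) ^ 2 := by ring
  have p3 : ‖v‖ ^ 4 = (‖v‖ ^ 2) ^ 2 := by ring
  have p4 : ‖w‖ ^ 4 = (‖w‖ ^ 2) ^ 2 := by ring
  rw [p1, p2, p3, p4, e1, e2]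
  ring

/-- **Bilinear gain ceiling, pointwise in `ω`.** The positive part of the quartic increment is at most
`2‖v‖²‖w‖²` — quadratic, never quartic, in the faster partner — for EVERY impact geometry; saturated
by the complete transfer `Disproof.reflectVel_focus` (`Δ₄ = +2a⁴`). [folklore] -/
theorem quartic_collision_gain_le (v w ω : V3) (hω : ‖ω‖ = 1) :
    ‖(reflectVel ω (v, w)).1‖ ^ 4 + ‖(reflectVel ω (v, w)).2‖ ^ 4 - ‖v‖ ^ 4 - ‖w‖ ^ 4
      ≤ 2 * ‖v‖ ^ 2 * ‖w‖ ^ 2 := by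
  rw [quartic_collision_identity v w ω hω]
  have ha : ⟪v, ω⟫_ℝ ^ 2 ≤ ‖v‖ ^ 2 := by
    have h := abs_real_inner_le_norm v ω
    rw [hω, mul_one] at h
    nlinarith [abs_nonneg ⟪v, ω⟫_ℝ, sq_abs ⟪v, ω⟫_ℝ]
  have hb : ⟪w, ω⟫_ℝ ^ 2 ≤ ‖w‖ ^ 2 := by
    have h := abs_real_inner_le_norm w ω
    rw [hω, mul_one] at h
    nlinarith [abs_nonneg ⟪w, ω⟫_ℝ, sq_abs ⟪w, ω⟫_ℝ]
  nlinarith [mul_nonneg (sub_nonneg.2 ha) (sub_nonneg.2 hb),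
    mul_nonneg (sq_nonneg ⟪v, ω⟫_ℝ) (sq_nonneg ⟪w, ω⟫_ℝ),
    mul_nonneg (sq_nonneg ⟪v, ω⟫_ℝ) (sub_nonneg.2 ha),
    mul_nonneg (sq_nonneg ⟪w, ω⟫_ℝ) (sub_nonneg.2 hb)]

/-- **Kinematic gain suppression (thin-set form; lead 1, cycle 2).**  The quartic gain of one
collision lives on TWO THIN SETS of impact geometries: with `a = ⟪v,ω⟫`, `b = ⟪w,ω⟫`,
`(Δ₄)₊ ≤ 2‖v‖²‖w‖² · (𝟙{‖v‖² − a² < ‖w‖²} + 𝟙{a² < b²})`.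
For a FAST `v` on a SLOW `w` the first set (`v` nearly parallel to `ω`: head-on, `‖v⊥‖ < ‖w‖`) has
kernel-weighted solid angle `≍ ‖w‖²/‖v‖²` and the second (`v` grazing, kicked by `w`: `|⟪v,ω⟫| < |⟪w,ω⟫|`)
has kernel weight `≍ ‖w‖²/‖v‖²` as well, so the FLUX-AVERAGED gain per fast–thermal collision is
`O(‖w‖⁴) = O(θ²)`, independent of `‖v‖` — against the worst case `2‖v‖²‖w‖²` of
`quartic_collision_gain_le`.  (Pointwise statement only; the solid-angle smallness is for whoever
integrates against the collision kernel — the refinement of stub S2a planned for cycle 3.)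
Proof: `Δ₄ = 2(a²−b²)((‖w‖²−b²) − (‖v‖²−a²))`; if `a² ≥ b²` a gain needs `‖v‖²−a² < ‖w‖²−b² ≤ ‖w‖²`
and is `≤ 2a²(‖w‖²−b²) ≤ 2‖v‖²‖w‖²`; if `a² < b²` it is `≤ 2b²(‖v‖²−a²) ≤ 2‖w‖²‖v‖²`. [folklore] -/
theorem quartic_collision_gain_le_thin (v w ω : V3) (hω : ‖ω‖ = 1) :
    max (‖(reflectVel ω (v, w)).1‖ ^ 4 + ‖(reflectVel ω (v, w)).2‖ ^ 4 - ‖v‖ ^ 4 - ‖w‖ ^ 4) 0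
      ≤ 2 * ‖v‖ ^ 2 * ‖w‖ ^ 2 *
        ((if ‖v‖ ^ 2 - ⟪v, ω⟫_ℝ ^ 2 < ‖w‖ ^ 2 then (1 : ℝ) else 0) +
          (if ⟪v, ω⟫_ℝ ^ 2 < ⟪w, ω⟫_ℝ ^ 2 then (1 : ℝ) else 0)) := by
  rw [quartic_collision_identity v w ω hω]
  have ha : ⟪v, ω⟫_ℝ ^ 2 ≤ ‖v‖ ^ 2 := by
    have h := abs_real_inner_le_norm v ω
    rw [hω, mul_one] at h
    nlinarith [abs_nonneg ⟪v, ω⟫_ℝ, sq_abs ⟪v, ω⟫_ℝ]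
  have hb : ⟪w, ω⟫_ℝ ^ 2 ≤ ‖w‖ ^ 2 := by
    have h := abs_real_inner_le_norm w ω
    rw [hω, mul_one] at h
    nlinarith [abs_nonneg ⟪w, ω⟫_ℝ, sq_abs ⟪w, ω⟫_ℝ]
  set A := ⟪v, ω⟫_ℝ ^ 2 with hA
  set B := ⟪w, ω⟫_ℝ ^ 2 with hB
  have hA0 : 0 ≤ A := sq_nonneg _
  have hB0 : 0 ≤ B := sq_nonneg _
  have hvw : 0 ≤ 2 * ‖v‖ ^ 2 * ‖w‖ ^ 2 := by positivity
  by_cases hAB : A < B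
  · -- grazing channel: the second indicator is on
    rw [if_pos hAB]
    have h1 : -2 * (A - B) * ((‖v‖ ^ 2 - A) - (‖w‖ ^ 2 - B)) ≤ 2 * ‖v‖ ^ 2 * ‖w‖ ^ 2 := by
      nlinarith [mul_nonneg (sub_nonneg.2 hAB.le) (sub_nonneg.2 ha),
        mul_nonneg (sub_nonneg.2 hAB.le) (sub_nonneg.2 hb), mul_nonneg hA0 (sub_nonneg.2 ha),
        mul_nonneg hB0 hA0]
    refine max_le ?_ ?_
    · calc -2 * (A - B) * ((‖v‖ ^ 2 - A) - (‖w‖ ^ 2 - B)) ≤ 2 * ‖v‖ ^ 2 * ‖w‖ ^ 2 := h1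
        _ = 2 * ‖v‖ ^ 2 * ‖w‖ ^ 2 * (0 + 1) := by ring
        _ ≤ _ := by
            gcongr
            split_ifs <;> norm_num
    · positivity
  · -- head-on channel (`A ≥ B`): a gain forces the first indicator on
    rw [if_neg hAB]
    replace hAB : B ≤ A := not_lt.1 hAB
    by_cases hthin : ‖v‖ ^ 2 - A < ‖w‖ ^ 2
    · rw [if_pos hthin]
      have h1 : -2 * (A - B) * ((‖v‖ ^ 2 - A) - (‖w‖ ^ 2 - B)) ≤ 2 * ‖v‖ ^ 2 * ‖w‖ ^ 2 := by
        nlinarith [mul_nonneg (sub_nonneg.2 hAB) (sub_nonneg.2 ha),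
          mul_nonneg (sub_nonneg.2 hAB) (sub_nonneg.2 hb), mul_nonneg hB0 (sub_nonneg.2 hb),
          mul_nonneg hA0 hB0]
      refine max_le (by linarith) (by positivity)
    · rw [if_neg hthin]
      replace hthin : ‖w‖ ^ 2 ≤ ‖v‖ ^ 2 - A := not_lt.1 hthin
      have h1 : -2 * (A - B) * ((‖v‖ ^ 2 - A) - (‖w‖ ^ 2 - B)) ≤ 0 := by
        have hD : 0 ≤ A - B := sub_nonneg.2 hAB
        have hS : 0 ≤ (‖v‖ ^ 2 - A) - (‖w‖ ^ 2 - B) := by linarith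
        nlinarith [mul_nonneg hD hS]
      refine max_le (by linarith) (by norm_num)

/-- **Equalising collisions dissipate the quartic functional** (`E₂ ≤ E₁′ ≤ E₁`). [folklore] -/
theorem quartic_collision_nonpos_of_equalising (v w ω : V3) (hω : ‖ω‖ = 1)
    (h₁ : ‖w‖ ^ 2 ≤ ‖(reflectVel ω (v, w)).1‖ ^ 2) (h₂ : ‖(reflectVel ω (v, w)).1‖ ^ 2 ≤ ‖v‖ ^ 2) :
    ‖(reflectVel ω (v, w)).1‖ ^ 4 + ‖(reflectVel ω (v, w)).2‖ ^ 4 - ‖v‖ ^ 4 - ‖w‖ ^ 4 ≤ 0 := by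
  rw [quartic_collision_identity v w ω hω]
  rw [norm_sq_reflectVel_fst v w ω hω] at h₁ h₂
  have hD : 0 ≤ ⟪v, ω⟫_ℝ ^ 2 - ⟪w, ω⟫_ℝ ^ 2 := by linarith
  have hS : 0 ≤ (‖v‖ ^ 2 - ⟪v, ω⟫_ℝ ^ 2) - (‖w‖ ^ 2 - ⟪w, ω⟫_ℝ ^ 2) := by linarith
  nlinarith [mul_nonneg hD hS]

/-- **A resting (or slower, co-moving) target can only be equalised**: with `⟪w,ω⟫ = 0` and
`‖w‖² ≤ ‖v‖² − ⟪v,ω⟫²` the increment is `−2a²((‖v‖² − a²) − ‖w‖²) ≤ 0`; for `w = 0` it equals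
`−2 cos²ψ sin²ψ ‖v‖⁴`, whose flux-uniform mean is `−‖v‖⁴/3` (triage r1-1 §A, r1-3 (b1)). [folklore] -/
theorem quartic_collision_nonpos_of_target_normal_rest (v w ω : V3) (hω : ‖ω‖ = 1)
    (hw : ⟪w, ω⟫_ℝ = 0) (hslow : ‖w‖ ^ 2 ≤ ‖v‖ ^ 2 - ⟪v, ω⟫_ℝ ^ 2) :
    ‖(reflectVel ω (v, w)).1‖ ^ 4 + ‖(reflectVel ω (v, w)).2‖ ^ 4 - ‖v‖ ^ 4 - ‖w‖ ^ 4 ≤ 0 := by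
  rw [quartic_collision_identity v w ω hω, hw]
  have hS : 0 ≤ (‖v‖ ^ 2 - ⟪v, ω⟫_ℝ ^ 2) - (‖w‖ ^ 2 - 0 ^ 2) := by linarith
  nlinarith [mul_nonneg (sq_nonneg ⟪v, ω⟫_ℝ) hS]

section Sharpness

/-- The unit vector `e_k` of `ℝ³` (as in `…Theorems.EnergyCurrentTailsNegative.e`). -/
def e (k : Fin 3) : V3 := EuclideanSpace.single k 1

/-- The unit vectors have norm one. -/
@[simp] theorem norm_e (k : Fin 3) : ‖e k‖ = 1 := by
  simp [e]

/-- **Complete energy transfer in one collision** — verbatim re-proof of the LANDED negative lemma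
`Summit.AtomisticToContinuum.HydrodynamicLimit.Theorems.EnergyCurrentTailsNegative.reflectVel_focus`
(`Theorems/EnergyCurrentTails/Negative/CollisionFocusing.lean`, p95063; re-proved only because that
module is not yet built on the farm): impact direction `e₀`, `(−a e₀, a e₁) ↦ (0, a e₁ − a e₀)`. -/
theorem focus_collision (a : ℝ) :
    reflectVel (e 0) (-(a • e 0), a • e 1) = ((0 : V3), a • e 1 - a • e 0) := by
  have h00 : @inner ℝ V3 _ (e 0) (e 0) = 1 := by
    rw [real_inner_self_eq_norm_sq, norm_e, one_pow]
  have h10 : @inner ℝ V3 _ (e 1) (e 0) = 0 := by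
    simp [e, EuclideanSpace.inner_single_left]
  have hc : @inner ℝ V3 _ (-(a • e 0) - a • e 1) (e 0) / ‖e 0‖ ^ 2 = -a := by
    rw [norm_e, one_pow, div_one, inner_sub_left, inner_neg_left, inner_smul_left,
      inner_smul_left, h00, h10]
    simp
  unfold reflectVel
  simp only [hc, Prod.mk.injEq]
  constructor
  · simp [neg_smul]
  · rw [neg_smul, ← sub_eq_add_neg]

/-- `‖a e₁ − a e₀‖² = 2a²` (as `EnergyCurrentTailsNegative.norm_sq_focus`). -/
theorem norm_sq_focus (a : ℝ) : ‖a • e 1 - a • e 0‖ ^ 2 = 2 * a ^ 2 := by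
  rw [EuclideanSpace.norm_sq_eq]
  simp [e, Fin.sum_univ_three]
  ring

/-- **The gain lemma is sharp, exactly on the landed focusing collision.**  For the complete transfer
`focus_collision` (= `EnergyCurrentTailsNegative.reflectVel_focus`, p95063; impact direction `e₀`,
`(−a e₀, a e₁) ↦ (0, a e₁ − a e₀)`) the quartic increment is `+2a⁴ = 2‖v‖²‖w‖²`, the ceiling of
`quartic_collision_gain_le`: the extreme ANTI-equalising collision, whose expected weight stub S2 prices
(this is how the line honours Disproof §5 — nothing is claimed monotone pathwise). [folklore] -/
theorem quartic_gain_saturated_by_focus (a : ℝ) :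
    ‖(reflectVel (e 0) (-(a • e 0), a • e 1)).1‖ ^ 4 + ‖(reflectVel (e 0) (-(a • e 0), a • e 1)).2‖ ^ 4
        - ‖-(a • e 0)‖ ^ 4 - ‖a • e 1‖ ^ 4
      = 2 * ‖-(a • e 0)‖ ^ 2 * ‖a • e 1‖ ^ 2 := by
  have hn0 : ‖-(a • e 0)‖ = |a| := by rw [norm_neg, norm_smul, norm_e, mul_one, Real.norm_eq_abs]
  have hn1 : ‖a • e 1‖ = |a| := by rw [norm_smul, norm_e, mul_one, Real.norm_eq_abs]
  have h2 : ‖a • e 1 - a • e 0‖ ^ 4 = (2 * a ^ 2) ^ 2 := by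
    rw [show ‖a • e 1 - a • e 0‖ ^ 4 = (‖a • e 1 - a • e 0‖ ^ 2) ^ 2 by ring, norm_sq_focus a]
  have h4 : |a| ^ 4 = a ^ 4 := by
    rw [show |a| ^ 4 = (|a| ^ 2) ^ 2 by ring, sq_abs]
    ring
  rw [focus_collision a]
  dsimp only
  rw [norm_zero, h2, hn0, hn1, h4, sq_abs]
  ring

end Sharpness

/-! ## §1 The four stubs (sorries live ONLY here)

Notation of the docstrings, for a flow family `Φ N`, `λ_N = localGibbsLaw σ a₀ u₀ θ₀ N (Φ N)`:
* `y_N(r)   = ∫ (N+1)⁻¹ ∑ᵢ ‖vᵢ(r)‖⁴ dλ_N` (`vᵢ(r) = ((Φ N).flow r z i).2`), an `ℝ≥0∞`;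
* `Δ₄(col)  = ‖v₁⁺‖⁴ + ‖v₂⁺‖⁴ − ‖v₁⁻‖⁴ − ‖v₂⁻‖⁴` of a collision record `col` (`postVel`, `preVel`);
* `Gain_N(s,s′] = ∫ (N+1)⁻¹ collisionSum_{(s,s′]} (Δ₄)₊/2 dλ_N`,
  `Loss_N(s,s′] = ∫ (N+1)⁻¹ collisionSum_{(s,s′]} (Δ₄)₋/2 dλ_N` (ordered contact pairs count each
  collision twice, whence `/2`; `(x)₊ = max x 0`);
* `h_N = τ (N+1)^{-1/3}` — a window of `τ` bath mean free times up to the factor `√2πσ²√θ`. -/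

/-! ## §1c RESHAPE B (seat c6, 2026-08-17): QMF₄ᴸ ⟸ T ∧ I ∧ P — the first-partner split

The lagged kinetic-window mixing floor QMF₄ᴸ (reshape A) is DERIVED below from three registered stubs over the
FIRST-PARTNER objects (filed for review as the objects file
`Theorems/OneFlightGossipEngineEnergyCurrentTailsFirstPartnerObjects.lean`, namespace
`…Theorems.EnergyCurrentTailsFirstPartner`; LANDED p147870 + p148483, imported):
* T `stub_firstPartnerFloor : FirstPartnerFloor` — STATIC MESOSCOPIC tube-occupation floor under the fixed-time law
  (OPEN primitive; the line's new canonical lower content: no empty corridor ahead of ‖v‖⁴-typical lab-fast spheres);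
* I `stub_firstPartnerDisturbanceCeiling : FirstPartnerDisturbanceCeiling` — short-window disturbance CEILING (OPEN
  primitive, Enskog type, one rare participant);
* P `stub_firstPartnerPathwise : FirstPartnerPathwise` — sure kinematics (provable now: `stub_markedTransfer`,
  `stub_realisedDatum` of the RateFloor line);
* glue G1 `stub_windowMixingRateFloor_of_firstPartner : T → I → P → W` (ℝ≥0∞ arithmetic + Q0 finiteness) and
  G2 `stub_quarticMixingFloor4L_of_windowRateFloor : W → QMF₄ᴸ` (disjoint sub-windows + offset averaging of the
  anchor over `(0, Δ]`, `Δ ≤ h_N/4`; no Tonelli, no time-measurability: `le_lintegral_add` and translation of Lebesgue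
  measure only) — both provable now;
* hook `firstPairs_subset_wouldBePairs` (one-liner; registered so that the objects file lands `--supports`).

SEAT c7 (2026-08-17, lead prover-line-…-9235-c7-0): the three open primitives are now ROUTE ITEMS (strategist split
gen 1 of the crux, ~13:50Z): T′ = stmt-18198, I′ = stmt-18199, S2a″ = stmt-18200 in `BallwiseInvariantReferences` (glue-by
`EnergyCurrentTails_of_firstPartner`), and {QMF₄ᴸ = stmt-18206, S2a″ = stmt-18207} in `JaynesSqueeze` (glue-by
`EnergyCurrentTails_of_mixingFloor4L`).  This seat's wave 1 LANDED the RUNG-0 CERTIFICATE of T′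
(`…QuarticSchurLedger.stub_firstPartnerFloorRung0`, p166957; helpers p164169 p164662 p165627; statements in
`Lines/quartic_schur_ledger_firstpartner_rung0.lean`), audited I′ (blocked, no producer; rung 0 feasible, XL) and
re-checked the S2a″ dock onto stmt-16939.  The skeleton's stub set is unchanged (3 sorries = the 3 child items).
-/

-- (objects: imported from `…Theorems.OneFlightGossipEngineEnergyCurrentTailsFirstPartnerObjects`, p147870 + p148483)

namespace Holds

open Summit.AtomisticToContinuum.HydrodynamicLimit.Theorems.EnergyCurrentTailsFirstPartner
  Summit.AtomisticToContinuum.HydrodynamicLimit.Theorems.RateFloorLine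

/-- **Hook — first pairs are would-be pairs** (registered one-liner of the objects file; seat c6 reshape B). -/
theorem firstPairs_subset_wouldBePairs :
    ∀ {n : ℕ} (ε Δ : ℝ) (z : Config n (Fin 3) T3), firstPairs ε Δ z ⊆ wouldBePairs ε Δ z :=
  -- CLOSED: rides with the objects file, p147870.
  Summit.AtomisticToContinuum.HydrodynamicLimit.Theorems.EnergyCurrentTailsFirstPartner.firstPairs_subset_wouldBePairs

/-- **Stub T — THE FIRST-PARTNER FLOOR** (seat c6 reshape B; OPEN primitive, crux-strength; STATIC and MESOSCOPIC:
a statement about the (1+1)-body structure of the fixed-time law `λ_r` ahead of the lab-fast spheres at the scale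
`Δ‖v − w‖ ≫ ε_N`; beyond entropy; why it might fail: empty corridors / co-moving platoons / depleted wakes ahead of a
positive ‖v‖⁴-fraction of the fast spheres at some time).  Registered in the MESOSCOPIC form T′
`EnergyCurrentTailsFirstPartner.FirstPartnerFloorMeso` (look-ahead ratio by look-ahead ratio, `c = c(τ₁)`; the first
version `FirstPartnerFloor` — one `c` for all `Δ ≤ τ₀h`, hence a contact-scale floor as `Δ ↓ 0` — implies it).
SEAT c7 (2026-08-17): now ALSO the route item stmt-AtomisticToContinuum-18198
`BallwiseInvariantReferences.FirstPartnerFloorMeso` (strategist split gen 1, Iff.rfl; glue-by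
`…QuarticSchurLedger.EnergyCurrentTails_of_firstPartner`).  RUNG 0 CERTIFIED (seat c7 wave 1, all LANDED):
`…Theorems.QuarticSchurLedger.stub_firstPartnerFloorRung0` (p166957) = this statement at CONSTANT profiles, every
`0 < σ < σ₀`, every flow family, all `r ∈ [0,T]`, with `K₀ = K₁ = 1`, `c = (1−16λ)Θ̄/(4(Q+1))`, explicit `τ₀(σ,u,θ)` — from
Gibbs invariance (`map_flow_localGibbsLaw_const` + `lintegral_map_le` for the non-measurable first-partner functional),
the sure transfer `firstPartnerRung0_pathwise` (p164169: band tube sum ≤ (N+1)·firstPartnerSum + C_K·#{out-degree ≥ 2},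
out-degree one within `κε ≤ Δ` ⇒ first pair within `Δ`), the N-UNIFORM 3-label excess statics `firstPartnerRung0_excess`
(p164662: `≤ 1024 (N+1)³ε⁴h²(‖u‖²+3θ)`, Ruelle `posGibbs_tripleEvent_le`), c2's tube mean
`sum_pair_tubeMark_mean_ge_of_measurable` and the positivity `firstPartnerRung0_markPositive` (p165627).  The typing of T′
(c6 v2) is thereby validated at rung 0 (mesoscopic look-ahead `κ = τ₁/σ` diameters, N-uniform constants). -/
theorem stub_firstPartnerFloor : FirstPartnerFloorMeso := by
  sorry

/-- **Stub I — THE FIRST-PARTNER DISTURBANCE CEILING** (seat c6 reshape B; OPEN primitive, a short-window CEILING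
of Enskog type with one rare participant; why it might fail: dynamical over-production of three-body encounters
around fast spheres — the same species as S2a″ / stmt-16939).  Registered in the slack-free SHARE form I′
`EnergyCurrentTailsFirstPartner.FirstPartnerRealisedShare` (`E[first] ≤ A·E[realisedFirst]`, `A ≥ 1` free).
SEAT c7 (2026-08-17): now ALSO the route item stmt-AtomisticToContinuum-18199
`BallwiseInvariantReferences.FirstPartnerRealisedShare` (split gen 1, Iff.rfl).  Worker audit (seat c7 wave 1,
`work/stubs/I-prime-analysis.md`, attached to 18199): typing clean (dead corners K₁ ≤ 0 / N = 1 harmless; Δ ↓ 0 at fixed N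
gives share → 0, no cheap falsity); NOT docked: stmt-16939 ⊬ I′ (two-label velocity marks cannot carry the three-label
smallness σ²τ₀ of the share) and RateFloor `stub_noBursts` ⊬ I′ (species matches pathwise — #disturbed-first ≤ #multiPairs +
2·secondaryCount — but mark-free / in-probability / lattice-tiled / b > 1/3); rung 0 FEASIBLE from landed tools but XL
(≈ 2 400 lines: sure charging L1 + 3/4-label window statics L2–L3″ + Δ-uniform floor L4 + assembly L5, A = 2). -/
theorem stub_firstPartnerDisturbanceCeiling : FirstPartnerRealisedShare := by
  sorry

/-- **Stub P — THE FIRST-PARTNER PATHWISE TRANSFER** (seat c6 reshape B; provable now, M–L: realised first pairs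
are realised would-be pairs (`realisedFirstSum ≤ realisedSum` termwise, marks ≥ 0), `RateFloorMarkedTransfer.stub_markedTransfer`
fed with `RateFloorRealisedDatum.stub_realisedDatum` bounds the realised sum by the real collision functional of the mark
`mixMark` read at the ACTUAL incoming datum, and on the good set that functional, cast to `ℝ≥0∞`, is `≤ mixingFlux`
(contact ⇔ `‖sepVec‖ = ε` in the domain; `reflectVel ∘ reflectVel = id`; `collidePair_apply_left`; drop the partner
cut)). See `EnergyCurrentTailsFirstPartner.FirstPartnerPathwise`. -/
theorem stub_firstPartnerPathwise : FirstPartnerPathwise :=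
  -- CLOSED (seat c6 wave 2): `…Theorems.QuarticSchurLedger.stub_firstPartnerPathwise`, p149750.
  Summit.AtomisticToContinuum.HydrodynamicLimit.Theorems.QuarticSchurLedger.stub_firstPartnerPathwise

/-- **Stub G1 — THE ANCHORED WINDOW RATE FLOOR FROM T′, I′, P** (seat c6 reshape B; provable now, S–M, a plain chain:
`τ₁ := min τ₀ᵀ (min τ₀ᴵ (1/4))`, `c := c(τ₁)` from T′, then for an anchor `a` with look-ahead `Δ = τ₁h`:
`cνΔ·E[fast(a)] ≤ E[firstPartnerSum] ≤ A·E[realisedFirstSum] ≤ A·E[mixingFlux (a, a+Δ]]` (P a.e. on the good set,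
`lintegral_mono_ae`), i.e. W′ with `c/A`; no finiteness, no absorption). -/
theorem stub_windowMixingRateFloor_of_firstPartner :
    FirstPartnerFloorMeso → FirstPartnerRealisedShare → FirstPartnerPathwise → WindowMixingRateFloorOne :=
  -- CLOSED (seat c6, lead): `…Theorems.QuarticSchurLedger.stub_windowMixingRateFloor_of_firstPartner`, p149352.
  Summit.AtomisticToContinuum.HydrodynamicLimit.Theorems.QuarticSchurLedger.stub_windowMixingRateFloor_of_firstPartner

/-- **Stub G2 — QMF₄ᴸ FROM THE ANCHORED ONE-LOOK-AHEAD RATE FLOOR W′** (seat c6 reshape B; provable now, M–L, pure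
bookkeeping: with `h = (N+1)^{-1/3}`, `Δ := τ₁·h` (`τ₁ ≤ 1/4` from W′), `K := ⌊1/τ₁⌋ − 1`: for every offset `θ ∈ (0, Δ]` the sub-windows
`(s+θ+kΔ, s+θ+(k+1)Δ]`, `k < K`, are disjoint and inside `(s, s+h]`, so a.e. (good set, finitely many collisions)
`mixingFlux (s, s+h] ≥ Σ_k mixingFlux (sub-window k)` and, by W at the anchors `s+θ+kΔ`,
`E[mixingFlux (s,s+h]] ≥ cνΔ Σ_k E[fast](s+θ+kΔ)`; integrate `dθ` over `(0, Δ]` (left side constant), use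
`∫Σ ≥ Σ∫` (`le_lintegral_add`, no measurability in time needed), translate each piece
(`MeasurableEmbedding.lintegral_map` for `θ ↦ θ + c` and `Real.volume`) and glue the `Ioc`'s into
`(s, s+KΔ] ⊇ (s, s+h/2]`: `Δ·E[mixingFlux (s,s+h]] ≥ cνΔ ∫_{(s,s+h/2]} E[fast]`, cancel `Δ`). -/
theorem stub_quarticMixingFloor4L_of_windowRateFloor : WindowMixingRateFloorOne → QuarticMixingFloor4L :=
  -- CLOSED (seat c6 wave 2): `…Theorems.QuarticSchurLedger.stub_quarticMixingFloor4L_of_windowRateFloor`, p149786.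
  Summit.AtomisticToContinuum.HydrodynamicLimit.Theorems.QuarticSchurLedger.stub_quarticMixingFloor4L_of_windowRateFloor

end Holds

namespace Holds

/-- **Stub L — THE QUARTIC LEDGER (exact, in expectation; CLOSED p97111).**  For `0 < σ < 1/2`, every `N`, every
hard-sphere flow `Φ` and `0 ≤ s ≤ s′`:  `y(s′) + Loss(s,s′] = y(s) + Gain(s,s′]` as extended
non-negative reals.  Pathwise on `Φ.good` (a `λ_N`-conull set, `localGibbsLaw_compl_good_eq_zero`):
velocities are constant on free flights and jump by `reflectVel` at the binary collisions
(`IsHardSphereTrajectory.free/binary`; regular torus geometry for `ε_N ≤ σ < 1/2`,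
`Torus.isHardSphereRegular_geometry`, so `contactPairs = {(p,q),(q,p)}`, `contactPairs_eq_pair`), hence
`∑ᵢ‖vᵢ(s′)‖⁴ − ∑ᵢ‖vᵢ(s)‖⁴ = ½ collisionSum_{(s,s′]} Δ₄ = Gain − Loss` (finite telescoping over
`collisionSum_eq_finset_sum`); then `ofReal` of non-negative reals is additive and `lintegral_add_left`
needs measurability of the `y`-integrand only (`HardSphereFlow.measurable_flow`) — NO integrability of
the collision count is required in this `ℝ≥0∞` form (triage r1-2's caveat is thereby void).
Provable now; L-sized (the ideator's `quartic_telescoping`). -/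
theorem stub_quarticLedger :
    ∀ (a₀ θ₀ : T3 → ℝ) (u₀ : T3 → V3) (σ : ℝ), 0 < σ → σ < 1 / 2 →
      ∀ (N : ℕ) (Φ : HardSphereFlow (Torus.geometry (Fin 3)) (hsDiameter σ N) (N + 1)) (s s' : ℝ),
        0 ≤ s → s ≤ s' →
          (∫⁻ z, ENNReal.ofReal (((N : ℝ) + 1)⁻¹ * ∑ i : Fin (N + 1), ‖(Φ.flow s' z i).2‖ ^ 4)
              ∂(localGibbsLaw σ a₀ u₀ θ₀ N Φ)) +
            (∫⁻ z, ENNReal.ofReal (((N : ℝ) + 1)⁻¹ *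
                Φ.collisionSum (Set.Ioc s s')
                  (fun col => max (‖col.preVel.1‖ ^ 4 + ‖col.preVel.2‖ ^ 4
                    - ‖col.postVel.1‖ ^ 4 - ‖col.postVel.2‖ ^ 4) 0 / 2) z)
              ∂(localGibbsLaw σ a₀ u₀ θ₀ N Φ))
          = (∫⁻ z, ENNReal.ofReal (((N : ℝ) + 1)⁻¹ * ∑ i : Fin (N + 1), ‖(Φ.flow s z i).2‖ ^ 4)
              ∂(localGibbsLaw σ a₀ u₀ θ₀ N Φ)) +
            (∫⁻ z, ENNReal.ofReal (((N : ℝ) + 1)⁻¹ *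
                Φ.collisionSum (Set.Ioc s s')
                  (fun col => max (‖col.postVel.1‖ ^ 4 + ‖col.postVel.2‖ ^ 4
                    - ‖col.preVel.1‖ ^ 4 - ‖col.preVel.2‖ ^ 4) 0 / 2) z)
              ∂(localGibbsLaw σ a₀ u₀ θ₀ N Φ)) :=
  -- CLOSED (lead 1, wave 1): landed as `…Theorems.QuarticSchurLedger.stub_quarticLedger`, p97111.
  Summit.AtomisticToContinuum.HydrodynamicLimit.Theorems.QuarticSchurLedger.stub_quarticLedger

/-- **Stub Q0 — QUARTIC CONTENT OF THE DATUM AND CRUDE FINITENESS ALONG THE FLOW.**  For continuous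
positive profiles there is `σ₀ > 0` (`1/2` works) such that for `0 < σ < σ₀` and every flow family:
(i) `y_N(0) ≤ B` for all `N ≥ N₀`, with `B = B(max θ₀, max ‖u₀‖)` — given the positions the local
Gibbs velocities are independent Gaussians `M_{1,u₀(x),θ₀(x)}`, `E‖v‖⁴ = 15θ² + 10θ|u|² + |u|⁴`
(`lintegral_localGibbsMeasure`-type disintegration as in the lead's `stub_exergyInfluence_initial`,
p91811, and `(Φ N).flow 0 = id` on the conull good set); (ii) for each `N` a crude bound
`y_N(r) ≤ B′_N` for ALL `r` — pathwise `∑ᵢ‖vᵢ(r)‖⁴ ≤ (∑ᵢ‖vᵢ(r)‖²)² = (∑ᵢ‖vᵢ(0)‖²)²` by energy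
conservation on the good set (`IsHardSphereTrajectory.configEnergy_eq`, discharged by `configEnergy_eq_holds`), and
`E_{λ_N}(∑ᵢ‖vᵢ‖²)² < ∞`.  Only (i) enters the final constant; (ii) merely licenses real arithmetic
in the recursion.  Provable now; M-sized. -/
theorem stub_quarticData :
    ∀ (a₀ θ₀ : T3 → ℝ) (u₀ : T3 → V3), Continuous a₀ → Continuous θ₀ → Continuous u₀ →
      (∀ x, 0 < a₀ x) → (∀ x, 0 < θ₀ x) →
      ∃ σ₀ : ℝ, 0 < σ₀ ∧ ∀ σ : ℝ, 0 < σ → σ < σ₀ →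
        ∀ Φ : (N : ℕ) → HardSphereFlow (Torus.geometry (Fin 3)) (hsDiameter σ N) (N + 1),
          ∃ B : ℝ, 0 ≤ B ∧ ∃ N₀ : ℕ, ∀ N : ℕ, N₀ ≤ N →
            (∫⁻ z, ENNReal.ofReal (((N : ℝ) + 1)⁻¹ *
                ∑ i : Fin (N + 1), ‖((Φ N).flow 0 z i).2‖ ^ 4)
              ∂(localGibbsLaw σ a₀ u₀ θ₀ N (Φ N))) ≤ ENNReal.ofReal B ∧
            ∃ B' : ℝ, ∀ r : ℝ,
              (∫⁻ z, ENNReal.ofReal (((N : ℝ) + 1)⁻¹ *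
                  ∑ i : Fin (N + 1), ‖((Φ N).flow r z i).2‖ ^ 4)
                ∂(localGibbsLaw σ a₀ u₀ θ₀ N (Φ N))) ≤ ENNReal.ofReal B' := by
  -- CLOSED: `…Theorems.QuarticSchurLedger.stub_quarticData` (p100638, seat c1; module built, seat a1).
  exact Summit.AtomisticToContinuum.HydrodynamicLimit.Theorems.QuarticSchurLedger.stub_quarticData

/- RECORD (seat c5): seat a1's docking stub CID (`stub_contactIntensityDomination :
JeansLoadedDice.ContactIntensityDomination`, = stmt-9218 verbatim) is FALSE — refuted at rung ½ by seat c4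
(`Theorems/JeansLoadedDiceContactIntensityDominationRefutation.lean`, p129870:
`…Theorems.not_ContactIntensityDomination`; stmt-9218 closed refuted 2026-08-17T00:29Z; the decl has since
been REMOVED from `Theses/JeansLoadedDice.lean` by the route repair of 00:59Z, which filed the repaired
ONE-RARE-PARTICIPANT ceiling as the shared item stmt-AtomisticToContinuum-16939
`JeansLoadedDice.ContactIntensityDominationOneRare`).  CID is REMOVED from the skeleton together with its
glue `stub_energyFluxCeiling_of_contactIntensityDomination` (landed p126789, now vacuous); the line's
upper content is re-homed on the bulk ceiling S2a″ below (whose typed producer is stmt-16939, dock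
`stub_energyFluxCeilingWindows_of_oneRare`), its lower content on RF₂ ∧ SD. -/

/-- **Stub S2a″ — THE ENERGY-FLUX CEILING ON ALL WINDOWS, EULER-FREE (seat c5 reshape; OPEN,
crux-strength; the line's canonical UPPER statement, replacing the REFUTED docking stub CID =
stmt-9218 `ContactIntensityDomination`, `…Theorems.not_ContactIntensityDomination`, p129870, seat c4).**
Along the deterministic flow from local Gibbs data, for every horizon `T > 0` and flow family there are
`C ≥ 0` and `N₀` such that for `N ≥ N₀` and `0 ≤ s ≤ s′ ≤ T`:
`E_{λ_N}[(N+1)⁻¹ Σ_{ordered collision records in (s,s′]} ‖v₁⁻‖²‖v₂⁻‖²]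
   ≤ C · σ²(N+1)^{1/3}(s′−s) · (sup_{r∈[s,s′]} m₂(r)) · (sup_{r∈[s,s′]} m₃(r))`
— the pre-collisional pair flux tested against the ONE bilinear mark `‖v‖²‖w‖²` the quartic gain lemma
produces (`quartic_collision_gain_le`) is at most `C ×` its Boltzmann–Enskog value on the moments of the
particle-averaged one-body law.  A BULK statement (no rare participant, no mark-uniform constant, ONE copy
of the law on the right through its own moments): it PASSES rung 0 for all windows (certificate
`…Theorems.QuarticSchurLedger.stub_energyFluxCeilingRung0`, p102898, `K₀ = 16∫‖w−v‖(‖v‖²+‖w‖²)²/4 dN⊗N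
/(E‖w‖²E‖w‖³)`) and rung ½ (seat c4's audit: inhomogeneous local Gibbs data at `s = 0⁺`, ratio
`≤ (θmax/θmin)^{5/2} sup ρ̂`, `LEAD-seat-c4-rung-half.md` §2), so c4's hot-spot Laplace mechanism, which
killed the two-copy mark-uniform CID, cannot touch it.  It is S2a (`stub_energyFluxCeiling`, crux frame,
kinetic windows) without the (idle) Euler/LLN hypotheses and for windows of any length — the form BOTH of
its consumers need: the dock S2a ⟸ S2a″ (`stub_energyFluxCeiling_of_windows`) and the mixed Povzner term
of the loss-intensity floor (`stub_lossIntensityFloor_of_rateSplitFlux`).  Equivalent to its kinetic-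
window restriction by finite subdivision (collision sums are additive in the window, the sups monotone).
WHY IT MIGHT FAIL: only by a DYNAMICAL over-production of fast–fast / fast–dense encounters under the
evolved law (transient hot micro-clusters; the focusing trees of Disproof §5b with non-vanishing weight);
no tree tool reaches it (entropy / Liouville / `f_s ≤ K^{N+1}g_N` are blind to collision COUNTS, Disproof
Finding 5).  Typed producers for the planners: c4's (γ) `ContactIntensityDominationOneRare` at `ψ(v) =
‖v‖²`, `k = 2` (`Lines/level_census_comparison_local_ceiling.lean`).
SEAT c7 (2026-08-17): now ALSO filed VERBATIM as the route items stmt-AtomisticToContinuum-18200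
(`BallwiseInvariantReferences.EnergyFluxCeilingWindows`, split gen 1 {T′, I′, S2a″}) and stmt-AtomisticToContinuum-18207
(`JaynesSqueeze.EnergyFluxCeilingWindows`, split gen 1 {QMF₄ᴸ = stmt-18206, S2a″}); the dock onto stmt-16939
(`stub_energyFluxCeilingWindows_of_oneRare`, p139311) re-checked intact on today's tree (worker probe rc 0);
`SpeedCapSurgery.ContactIntensityDominationOneRare` and c4's (γ) are byte-identical to 16939 (no second producer). -/
theorem stub_energyFluxCeilingWindows :
    ∀ (a₀ θ₀ : T3 → ℝ) (u₀ : T3 → V3), Continuous a₀ → Continuous θ₀ → Continuous u₀ →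
      (∀ x, 0 < a₀ x) → (∀ x, 0 < θ₀ x) →
      ∃ σ₀ : ℝ, 0 < σ₀ ∧ ∀ σ : ℝ, 0 < σ → σ < σ₀ → ∀ T : ℝ, 0 < T →
        ∀ Φ : ((N : ℕ) → HardSphereFlow (Torus.geometry (Fin 3)) (hsDiameter σ N) (N + 1)),
          ∃ C : ℝ, 0 ≤ C ∧ ∃ N₀ : ℕ, ∀ N : ℕ, N₀ ≤ N → ∀ s s' : ℝ, 0 ≤ s → s ≤ s' → s' ≤ T →
            (∫⁻ z, ENNReal.ofReal (((N : ℝ) + 1)⁻¹ *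
                (Φ N).collisionSum (Set.Ioc s s')
                  (fun col => ‖col.preVel.1‖ ^ 2 * ‖col.preVel.2‖ ^ 2) z)
              ∂(localGibbsLaw σ a₀ u₀ θ₀ N (Φ N)))
            ≤ ENNReal.ofReal (C * (σ ^ 2 * ((N : ℝ) + 1) ^ (1 / 3 : ℝ) * (s' - s))) *
                (⨆ r ∈ Set.Icc s s',
                  (∫⁻ z, ENNReal.ofReal (((N : ℝ) + 1)⁻¹ *
                      ∑ i : Fin (N + 1), ‖((Φ N).flow r z i).2‖ ^ 2)
                    ∂(localGibbsLaw σ a₀ u₀ θ₀ N (Φ N)))) *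
                (⨆ r ∈ Set.Icc s s',
                  (∫⁻ z, ENNReal.ofReal (((N : ℝ) + 1)⁻¹ *
                      ∑ i : Fin (N + 1), ‖((Φ N).flow r z i).2‖ ^ 3)
                    ∂(localGibbsLaw σ a₀ u₀ θ₀ N (Φ N)))) := by
  sorry

/-- **Stub S2a-dock — S2a FROM S2a″ (glue; seat c5 reshape; provable now, S-sized).**  Given `t < T` and
`τ > 0` take the horizon `T″ := t + τ + 1 > 0` in S2a″; a kinetic window `[s, s′]`, `s ∈ [0,t]`,
`s′ ≤ s + τ(N+1)^{-1/3} ≤ t + τ`, lies in `[0, T″]`; `K := C`. -/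
theorem stub_energyFluxCeiling_of_windows :
    (∀ (a₀ θ₀ : T3 → ℝ) (u₀ : T3 → V3), Continuous a₀ → Continuous θ₀ → Continuous u₀ →
      (∀ x, 0 < a₀ x) → (∀ x, 0 < θ₀ x) →
      ∃ σ₀ : ℝ, 0 < σ₀ ∧ ∀ σ : ℝ, 0 < σ → σ < σ₀ → ∀ T : ℝ, 0 < T →
        ∀ Φ : ((N : ℕ) → HardSphereFlow (Torus.geometry (Fin 3)) (hsDiameter σ N) (N + 1)),
          ∃ C : ℝ, 0 ≤ C ∧ ∃ N₀ : ℕ, ∀ N : ℕ, N₀ ≤ N → ∀ s s' : ℝ, 0 ≤ s → s ≤ s' → s' ≤ T →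
            (∫⁻ z, ENNReal.ofReal (((N : ℝ) + 1)⁻¹ *
                (Φ N).collisionSum (Set.Ioc s s')
                  (fun col => ‖col.preVel.1‖ ^ 2 * ‖col.preVel.2‖ ^ 2) z)
              ∂(localGibbsLaw σ a₀ u₀ θ₀ N (Φ N)))
            ≤ ENNReal.ofReal (C * (σ ^ 2 * ((N : ℝ) + 1) ^ (1 / 3 : ℝ) * (s' - s))) *
                (⨆ r ∈ Set.Icc s s',
                  (∫⁻ z, ENNReal.ofReal (((N : ℝ) + 1)⁻¹ *
                      ∑ i : Fin (N + 1), ‖((Φ N).flow r z i).2‖ ^ 2)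
                    ∂(localGibbsLaw σ a₀ u₀ θ₀ N (Φ N)))) *
                (⨆ r ∈ Set.Icc s s',
                  (∫⁻ z, ENNReal.ofReal (((N : ℝ) + 1)⁻¹ *
                      ∑ i : Fin (N + 1), ‖((Φ N).flow r z i).2‖ ^ 3)
                    ∂(localGibbsLaw σ a₀ u₀ θ₀ N (Φ N))))) →
    ∀ (a₀ θ₀ : T3 → ℝ) (u₀ : T3 → V3), Continuous a₀ → Continuous θ₀ → Continuous u₀ →
      (∀ x, 0 < a₀ x) → (∀ x, 0 < θ₀ x) →
      ∃ σ₀ : ℝ, 0 < σ₀ ∧ ∀ σ : ℝ, 0 < σ → σ < σ₀ →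
        ∀ (T : ℝ) (ρ θ : ℝ → T3 → ℝ) (u : ℝ → T3 → V3), IsHardSphereEulerSolution σ T ρ u θ →
          ∀ Φ : (N : ℕ) → HardSphereFlow (Torus.geometry (Fin 3)) (hsDiameter σ N) (N + 1),
            TendstoHydroFieldsAt (fun N => localGibbsLaw σ a₀ u₀ θ₀ N (Φ N)) Φ ρ u θ 0 →
              ∀ t ∈ Set.Ico 0 T, ∀ τ : ℝ, 0 < τ → ∃ K : ℝ, 0 ≤ K ∧
                ∃ N₀ : ℕ, ∀ N : ℕ, N₀ ≤ N → ∀ s ∈ Set.Icc 0 t,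
                  ∀ s' ∈ Set.Icc s (s + τ * ((N : ℝ) + 1) ^ (-(1 / 3 : ℝ))),
                    (∫⁻ z, ENNReal.ofReal (((N : ℝ) + 1)⁻¹ *
                        (Φ N).collisionSum (Set.Ioc s s')
                          (fun col => ‖col.preVel.1‖ ^ 2 * ‖col.preVel.2‖ ^ 2) z)
                      ∂(localGibbsLaw σ a₀ u₀ θ₀ N (Φ N)))
                    ≤ ENNReal.ofReal (K * (σ ^ 2 * ((N : ℝ) + 1) ^ (1 / 3 : ℝ) * (s' - s))) *
                        (⨆ r ∈ Set.Icc s s',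
                          (∫⁻ z, ENNReal.ofReal (((N : ℝ) + 1)⁻¹ *
                              ∑ i : Fin (N + 1), ‖((Φ N).flow r z i).2‖ ^ 2)
                            ∂(localGibbsLaw σ a₀ u₀ θ₀ N (Φ N)))) *
                        (⨆ r ∈ Set.Icc s s',
                          (∫⁻ z, ENNReal.ofReal (((N : ℝ) + 1)⁻¹ *
                              ∑ i : Fin (N + 1), ‖((Φ N).flow r z i).2‖ ^ 3)
                            ∂(localGibbsLaw σ a₀ u₀ θ₀ N (Φ N)))) :=
  -- CLOSED (seat c5 wave 1): `…Theorems.QuarticSchurLedger.stub_energyFluxCeiling_of_windows`, p135409.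
  Summit.AtomisticToContinuum.HydrodynamicLimit.Theorems.QuarticSchurLedger.stub_energyFluxCeiling_of_windows

/-- **Stub S2a″-dock — S2a″ FROM THE SHARED ONE-RARE-PARTICIPANT CEILING stmt-16939 (glue onto an
EXISTING item; seat c5; provable now, M–L).**  `JeansLoadedDice.ContactIntensityDominationOneRare → S2a″`:
instantiate (γ) at `ψ(v) = ofReal ‖v‖²` (continuous), `k = 2`, horizon `T`; on the conull good set the
line's real collision sum of `‖v₁⁻‖²‖v₂⁻‖²` over ordered records is the route's `∑ᶠ` form (LANDED bridge
`leadBridge_ofReal_collisionSum_eq_finsum` + `ofConfig_preVel_eq_collidePair`, p126789) and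
`‖v‖²‖w‖² ≤ ‖v‖²(1+‖w‖)²` termwise; on the right `(1+‖w‖)²‖v−w‖‖v‖² ≤ ‖v‖³(1+‖w‖)² + ‖v‖²(1+‖w‖)²‖w‖`,
Tonelli over the two copies (as `leadBridge_double_sum_le`) gives `(N+1)²·[m₃·E(1+‖w‖)² + m₂·E(1+‖w‖)²‖w‖]`
with `E(1+‖w‖)² ≤ 2(1+m₂)`, `E(1+‖w‖)²‖w‖ ≤ 2(m₁+m₃)`; finally LOWER bounds make the bulk products
absorb the constants: `m₂(r) = m₂(0) ≥ 3·min θ₀ =: μ₂ > 0` (energy conservation on the good set,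
`IsHardSphereTrajectory.configEnergy_eq`, and the Gaussian disintegration `lintegral_localGibbsMeasure` at
`r = 0`; the law is a probability measure for `σ ≤ 1/2`) and `m₁ ≤ m₃^{1/3}`, `m₂ ≤ m₃^{2/3}` (Hölder /
Lyapunov for the probability measure `(N+1)⁻¹Σᵢ ⊗ λ_N`), so `1 + m₂ ≤ (1 + μ₂⁻¹) m₂`, `m₁ + m₃ ≤
(μ₂^{-1} + 1)·m₃`-type bounds; whence S2a″ with `C := C(γ) · c(μ₂)`.  (If the lower-bound bookkeeping
resists, land the weaker dock with right-hand side `C ν (s′−s)(1 + sup m₂)(1 + sup m₃)` as a separate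
lemma and report the exact missing inequality.) -/
theorem stub_energyFluxCeilingWindows_of_oneRare :
    Summit.AtomisticToContinuum.HydrodynamicLimit.Theses.JeansLoadedDice.ContactIntensityDominationOneRare →
    ∀ (a₀ θ₀ : T3 → ℝ) (u₀ : T3 → V3), Continuous a₀ → Continuous θ₀ → Continuous u₀ →
      (∀ x, 0 < a₀ x) → (∀ x, 0 < θ₀ x) →
      ∃ σ₀ : ℝ, 0 < σ₀ ∧ ∀ σ : ℝ, 0 < σ → σ < σ₀ → ∀ T : ℝ, 0 < T →
        ∀ Φ : ((N : ℕ) → HardSphereFlow (Torus.geometry (Fin 3)) (hsDiameter σ N) (N + 1)),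
          ∃ C : ℝ, 0 ≤ C ∧ ∃ N₀ : ℕ, ∀ N : ℕ, N₀ ≤ N → ∀ s s' : ℝ, 0 ≤ s → s ≤ s' → s' ≤ T →
            (∫⁻ z, ENNReal.ofReal (((N : ℝ) + 1)⁻¹ *
                (Φ N).collisionSum (Set.Ioc s s')
                  (fun col => ‖col.preVel.1‖ ^ 2 * ‖col.preVel.2‖ ^ 2) z)
              ∂(localGibbsLaw σ a₀ u₀ θ₀ N (Φ N)))
            ≤ ENNReal.ofReal (C * (σ ^ 2 * ((N : ℝ) + 1) ^ (1 / 3 : ℝ) * (s' - s))) *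
                (⨆ r ∈ Set.Icc s s',
                  (∫⁻ z, ENNReal.ofReal (((N : ℝ) + 1)⁻¹ *
                      ∑ i : Fin (N + 1), ‖((Φ N).flow r z i).2‖ ^ 2)
                    ∂(localGibbsLaw σ a₀ u₀ θ₀ N (Φ N)))) *
                (⨆ r ∈ Set.Icc s s',
                  (∫⁻ z, ENNReal.ofReal (((N : ℝ) + 1)⁻¹ *
                      ∑ i : Fin (N + 1), ‖((Φ N).flow r z i).2‖ ^ 3)
                    ∂(localGibbsLaw σ a₀ u₀ θ₀ N (Φ N)))) :=
  -- CLOSED (seat c5 wave 1): `…Theorems.QuarticSchurLedger.stub_energyFluxCeilingWindows_of_oneRare`, p139311 (+ prelim p138954).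
  Summit.AtomisticToContinuum.HydrodynamicLimit.Theorems.QuarticSchurLedger.stub_energyFluxCeilingWindows_of_oneRare

/-- **Stub S2a — THE ENERGY-WEIGHTED PRE-COLLISIONAL FLUX CEILING (crux-strength; OPEN; lead 1
reshape of S2).**  In the frame of the crux, for every `t < T` and window scale `τ > 0` there are
`K ≥ 0` and `N₀` such that for `N ≥ N₀`, `s ∈ [0,t]`, `s′ ∈ [s, s + τ(N+1)^{-1/3}]`:
`E_{λ_N}[(N+1)⁻¹ Σ_{ordered collision records in (s,s′]} ‖v₁⁻‖²‖v₂⁻‖²]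
   ≤ K · σ²(N+1)^{1/3}(s′−s) · (sup_{r∈[s,s′]} m₂(r)) · (sup_{r∈[s,s′]} m₃(r))`,
`m_k(r) = E_{λ_N}[(N+1)⁻¹Σᵢ‖vᵢ(r)‖ᵏ]` — i.e. the pre-collisional pair flux, tested against the
BILINEAR mark `‖v‖²‖w‖²` (the ceiling of the quartic gain, `quartic_collision_gain_le`), is at most
`K` times its molecular-chaos value computed from the moments of the particle-averaged one-body
marginal (`σ²(N+1)^{1/3}` = the collision clock `(N+1)ε_N²`; `|v − w| ≤ |v| + |w|`).  This is the
canonical open content of S2: a ONE-SIDED Stosszahlansatz (propagation of chaos as an UPPER bound at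
contact) under the EVOLVED law before the first shock, restricted to the one polynomial mark the line
needs; `K` absorbs `(sup ρ / inf ρ)·(θmax/θmin)^{5/2}`-type pre-shock factors of comparing local
with averaged marginals (a ceiling uniform over ALL marks would be false by polynomial factors for
marks living at `|v| → ∞`, since the averaged marginal is colder than the hottest point).  It is the
mark form of the census line's F1 (`stub_rateCeiling`).  Rung 0: holds with the constants of the
landed collision-flux bound — CERTIFIED: `…Theorems.QuarticSchurLedger.stub_energyFluxCeilingRung0`
(p102898; all `N ≥ 1`, all windows, `K₀ = 16∫‖w−v‖(‖v‖²+‖w‖²)²/4 dN⊗N/(E‖w‖²·E‖w‖³)`).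
WHY IT MIGHT FAIL: only by DYNAMICAL over-production of fast–fast / fast–dense encounters (transient
hot micro-clusters; the focusing trees of Disproof §5b with non-vanishing weight) — their `t = 0`
Gibbs weight is harmless.  No tree tool reaches it (entropy/Liouville blind, NOTES of lead 1). -/
theorem stub_energyFluxCeiling :
    ∀ (a₀ θ₀ : T3 → ℝ) (u₀ : T3 → V3), Continuous a₀ → Continuous θ₀ → Continuous u₀ →
      (∀ x, 0 < a₀ x) → (∀ x, 0 < θ₀ x) →
      ∃ σ₀ : ℝ, 0 < σ₀ ∧ ∀ σ : ℝ, 0 < σ → σ < σ₀ →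
        ∀ (T : ℝ) (ρ θ : ℝ → T3 → ℝ) (u : ℝ → T3 → V3), IsHardSphereEulerSolution σ T ρ u θ →
          ∀ Φ : (N : ℕ) → HardSphereFlow (Torus.geometry (Fin 3)) (hsDiameter σ N) (N + 1),
            TendstoHydroFieldsAt (fun N => localGibbsLaw σ a₀ u₀ θ₀ N (Φ N)) Φ ρ u θ 0 →
              ∀ t ∈ Set.Ico 0 T, ∀ τ : ℝ, 0 < τ → ∃ K : ℝ, 0 ≤ K ∧
                ∃ N₀ : ℕ, ∀ N : ℕ, N₀ ≤ N → ∀ s ∈ Set.Icc 0 t,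
                  ∀ s' ∈ Set.Icc s (s + τ * ((N : ℝ) + 1) ^ (-(1 / 3 : ℝ))),
                    (∫⁻ z, ENNReal.ofReal (((N : ℝ) + 1)⁻¹ *
                        (Φ N).collisionSum (Set.Ioc s s')
                          (fun col => ‖col.preVel.1‖ ^ 2 * ‖col.preVel.2‖ ^ 2) z)
                      ∂(localGibbsLaw σ a₀ u₀ θ₀ N (Φ N)))
                    ≤ ENNReal.ofReal (K * (σ ^ 2 * ((N : ℝ) + 1) ^ (1 / 3 : ℝ) * (s' - s))) *
                        (⨆ r ∈ Set.Icc s s',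
                          (∫⁻ z, ENNReal.ofReal (((N : ℝ) + 1)⁻¹ *
                              ∑ i : Fin (N + 1), ‖((Φ N).flow r z i).2‖ ^ 2)
                            ∂(localGibbsLaw σ a₀ u₀ θ₀ N (Φ N)))) *
                        (⨆ r ∈ Set.Icc s s',
                          (∫⁻ z, ENNReal.ofReal (((N : ℝ) + 1)⁻¹ *
                              ∑ i : Fin (N + 1), ‖((Φ N).flow r z i).2‖ ^ 3)
                            ∂(localGibbsLaw σ a₀ u₀ θ₀ N (Φ N)))) :=
  -- DERIVED (seat c5 reshape): S2a := dock(S2a″); its open content is S2a″ `stub_energyFluxCeilingWindows`.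
  stub_energyFluxCeiling_of_windows stub_energyFluxCeilingWindows

/-- **Stub S2b — THE GAIN CEILING FROM THE FLUX CEILING (glue; CLOSED p102356; lead 1 reshape).**
`Q0 → S2a → S2`: pathwise, pair energy conservation at each record
(`HardSphereCollisionRecord.ofConfig_norm_sq_preVel`) gives `(Δ₄)₊/2 ≤ ‖v₁⁻‖²‖v₂⁻‖²`
(`‖v⁺‖⁴+‖w⁺‖⁴ ≤ (‖v⁺‖²+‖w⁺‖²)² = (‖v⁻‖²+‖w⁻‖²)²`), so `Gain(s,s′] ≤` the flux functional of S2a;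
then `m₂(r) = m₂(0) ≤ 1 + B` (energy conservation on the good set, `‖v‖² ≤ 1 + ‖v‖⁴`, Q0(i)),
`m₃ ≤ √(m₂ m₄)` (Cauchy–Schwarz in `i` and in `λ_N`), `(N+1)^{1/3}(s′−s) ≤ τ`, and
`Kσ²τ(1+B)^{3/2}·√Y ≤ ηY + (Kσ²τ)²(1+B)³/(4η)` with `Y = sup_{[s,s′]} y_N` (finite by Q0(ii)) give S2
with `D(η) = (Kσ²τ)²(1+B)³/(4η)`. -/
theorem stub_gainCeiling_of_energyFluxCeiling :
     (∀ (a₀ θ₀ : T3 → ℝ) (u₀ : T3 → V3), Continuous a₀ → Continuous θ₀ → Continuous u₀ →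
        (∀ x, 0 < a₀ x) → (∀ x, 0 < θ₀ x) →
        ∃ σ₀ : ℝ, 0 < σ₀ ∧ ∀ σ : ℝ, 0 < σ → σ < σ₀ →
          ∀ Φ : (N : ℕ) → HardSphereFlow (Torus.geometry (Fin 3)) (hsDiameter σ N) (N + 1),
            ∃ B : ℝ, 0 ≤ B ∧ ∃ N₀ : ℕ, ∀ N : ℕ, N₀ ≤ N →
              (∫⁻ z, ENNReal.ofReal (((N : ℝ) + 1)⁻¹ *
                  ∑ i : Fin (N + 1), ‖((Φ N).flow 0 z i).2‖ ^ 4)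
                ∂(localGibbsLaw σ a₀ u₀ θ₀ N (Φ N))) ≤ ENNReal.ofReal B ∧
              ∃ B' : ℝ, ∀ r : ℝ,
                (∫⁻ z, ENNReal.ofReal (((N : ℝ) + 1)⁻¹ *
                    ∑ i : Fin (N + 1), ‖((Φ N).flow r z i).2‖ ^ 4)
                  ∂(localGibbsLaw σ a₀ u₀ θ₀ N (Φ N))) ≤ ENNReal.ofReal B') →
     (∀ (a₀ θ₀ : T3 → ℝ) (u₀ : T3 → V3), Continuous a₀ → Continuous θ₀ → Continuous u₀ →
        (∀ x, 0 < a₀ x) → (∀ x, 0 < θ₀ x) →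
        ∃ σ₀ : ℝ, 0 < σ₀ ∧ ∀ σ : ℝ, 0 < σ → σ < σ₀ →
          ∀ (T : ℝ) (ρ θ : ℝ → T3 → ℝ) (u : ℝ → T3 → V3), IsHardSphereEulerSolution σ T ρ u θ →
            ∀ Φ : (N : ℕ) → HardSphereFlow (Torus.geometry (Fin 3)) (hsDiameter σ N) (N + 1),
              TendstoHydroFieldsAt (fun N => localGibbsLaw σ a₀ u₀ θ₀ N (Φ N)) Φ ρ u θ 0 →
                ∀ t ∈ Set.Ico 0 T, ∀ τ : ℝ, 0 < τ → ∃ K : ℝ, 0 ≤ K ∧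
                  ∃ N₀ : ℕ, ∀ N : ℕ, N₀ ≤ N → ∀ s ∈ Set.Icc 0 t,
                    ∀ s' ∈ Set.Icc s (s + τ * ((N : ℝ) + 1) ^ (-(1 / 3 : ℝ))),
                      (∫⁻ z, ENNReal.ofReal (((N : ℝ) + 1)⁻¹ *
                          (Φ N).collisionSum (Set.Ioc s s')
                            (fun col => ‖col.preVel.1‖ ^ 2 * ‖col.preVel.2‖ ^ 2) z)
                        ∂(localGibbsLaw σ a₀ u₀ θ₀ N (Φ N)))
                      ≤ ENNReal.ofReal (K * (σ ^ 2 * ((N : ℝ) + 1) ^ (1 / 3 : ℝ) * (s' - s))) *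
                          (⨆ r ∈ Set.Icc s s',
                            (∫⁻ z, ENNReal.ofReal (((N : ℝ) + 1)⁻¹ *
                                ∑ i : Fin (N + 1), ‖((Φ N).flow r z i).2‖ ^ 2)
                              ∂(localGibbsLaw σ a₀ u₀ θ₀ N (Φ N)))) *
                          (⨆ r ∈ Set.Icc s s',
                            (∫⁻ z, ENNReal.ofReal (((N : ℝ) + 1)⁻¹ *
                                ∑ i : Fin (N + 1), ‖((Φ N).flow r z i).2‖ ^ 3)
                              ∂(localGibbsLaw σ a₀ u₀ θ₀ N (Φ N))))) →
     (∀ (a₀ θ₀ : T3 → ℝ) (u₀ : T3 → V3), Continuous a₀ → Continuous θ₀ → Continuous u₀ →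
        (∀ x, 0 < a₀ x) → (∀ x, 0 < θ₀ x) →
        ∃ σ₀ : ℝ, 0 < σ₀ ∧ ∀ σ : ℝ, 0 < σ → σ < σ₀ →
          ∀ (T : ℝ) (ρ θ : ℝ → T3 → ℝ) (u : ℝ → T3 → V3), IsHardSphereEulerSolution σ T ρ u θ →
            ∀ Φ : (N : ℕ) → HardSphereFlow (Torus.geometry (Fin 3)) (hsDiameter σ N) (N + 1),
              TendstoHydroFieldsAt (fun N => localGibbsLaw σ a₀ u₀ θ₀ N (Φ N)) Φ ρ u θ 0 →
                ∀ t ∈ Set.Ico 0 T, ∀ τ : ℝ, 0 < τ → ∀ η : ℝ, 0 < η → ∃ D : ℝ, 0 ≤ D ∧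
                  ∃ N₀ : ℕ, ∀ N : ℕ, N₀ ≤ N → ∀ s ∈ Set.Icc 0 t,
                    ∀ s' ∈ Set.Icc s (s + τ * ((N : ℝ) + 1) ^ (-(1 / 3 : ℝ))),
                      (∫⁻ z, ENNReal.ofReal (((N : ℝ) + 1)⁻¹ *
                          (Φ N).collisionSum (Set.Ioc s s')
                            (fun col => max (‖col.postVel.1‖ ^ 4 + ‖col.postVel.2‖ ^ 4
                              - ‖col.preVel.1‖ ^ 4 - ‖col.preVel.2‖ ^ 4) 0 / 2) z)
                        ∂(localGibbsLaw σ a₀ u₀ θ₀ N (Φ N)))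
                      ≤ ENNReal.ofReal D + ENNReal.ofReal η *
                          ⨆ r ∈ Set.Icc s s',
                            (∫⁻ z, ENNReal.ofReal (((N : ℝ) + 1)⁻¹ *
                                ∑ i : Fin (N + 1), ‖((Φ N).flow r z i).2‖ ^ 4)
                              ∂(localGibbsLaw σ a₀ u₀ θ₀ N (Φ N)))) := by
  -- CLOSED: `…Theorems.QuarticSchurLedger.stub_gainCeiling_of_energyFluxCeiling` (p102356; module built, seat a1).
  exact Summit.AtomisticToContinuum.HydrodynamicLimit.Theorems.QuarticSchurLedger.stub_gainCeiling_of_energyFluxCeiling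

/-- **Stub S2 — THE SUB-LINEAR (BILINEAR) WINDOW GAIN CEILING (crux-strength; since the lead's
reshape DERIVED := S2b Q0 S2a, no `sorry` of its own; its open content is S2a).**  In the frame of the
crux, for every `t < T`, every window length `τ > 0` and every slope `η > 0` there are `D ≥ 0` and `N₀`
such that for `N ≥ N₀`, `s ∈ [0,t]` and `s′ ∈ [s, s + τ(N+1)^{-1/3}]`:
`Gain_N(s,s′] ≤ D + η · sup_{r ∈ [s,s′]} y_N(r)`.
Intended proof shape (the card's S2 with the `m₃` bookkeeping folded in): per collision
`(Δ₄)₊ ≤ 2‖v‖²‖w‖²` for EVERY geometry (`quartic_collision_gain_le`) — attribute it to the faster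
particle; collisions among particles below a level `K₁Θ` contribute `≤ (window collision count per
particle, O(τ)) · 2K₁²Θ²` to `D`; a particle above `K₁Θ` meets `≍ τσ²‖v‖` partners per window
carrying THERMAL energy on average, giving `≲ τσ²Θ · (N+1)⁻¹∑‖vᵢ‖³ ≤ τσ²Θ √(m₂ · y)` with `m₂`
conserved (`IsHardSphereTrajectory.configEnergy_eq`) and `√(m₂y) ≤ ηy + m₂/(4η)`; the slope `η` then
only has to absorb the energy-weighted AFFINITY of particles above `K₁(η)Θ` for EQUALLY fast partners
(equilibrium: relative rate `e^{−K₁/2}`).  LEANS ON (declared, not typed here): the mesoscopic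
temperature cap S0 (as S1) and a multiplicative fast-sphere encounter-rate CEILING outside Θ-hot balls;
partial producer outside crowded cells: crux idea `fresh-directions-cannot-aim` (time-matched aiming
lemma, triage r1-1 §E); cousins: `CollisionActivityTails` (stmt-13734), `FastCollisionThroughput`
(stmt-13022).  WHY IT MIGHT FAIL: DYNAMICAL over-production of sub-mesoscopic hot micro-clusters
(fast–fast affinity at arbitrarily high levels with non-vanishing relative rate) — their `t = 0` Gibbs
count `≍ (N/n_c)e^{−c n_c Θ_hot/θ}` is harmless (triage r1-2), only the evolved law can break it;
the focusing trees of Disproof §5b are exactly the scenario whose expected weight this stub prices. -/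
theorem stub_gainCeiling :
    ∀ (a₀ θ₀ : T3 → ℝ) (u₀ : T3 → V3), Continuous a₀ → Continuous θ₀ → Continuous u₀ →
      (∀ x, 0 < a₀ x) → (∀ x, 0 < θ₀ x) →
      ∃ σ₀ : ℝ, 0 < σ₀ ∧ ∀ σ : ℝ, 0 < σ → σ < σ₀ →
        ∀ (T : ℝ) (ρ θ : ℝ → T3 → ℝ) (u : ℝ → T3 → V3), IsHardSphereEulerSolution σ T ρ u θ →
          ∀ Φ : (N : ℕ) → HardSphereFlow (Torus.geometry (Fin 3)) (hsDiameter σ N) (N + 1),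
            TendstoHydroFieldsAt (fun N => localGibbsLaw σ a₀ u₀ θ₀ N (Φ N)) Φ ρ u θ 0 →
              ∀ t ∈ Set.Ico 0 T, ∀ τ : ℝ, 0 < τ → ∀ η : ℝ, 0 < η → ∃ D : ℝ, 0 ≤ D ∧
                ∃ N₀ : ℕ, ∀ N : ℕ, N₀ ≤ N → ∀ s ∈ Set.Icc 0 t,
                  ∀ s' ∈ Set.Icc s (s + τ * ((N : ℝ) + 1) ^ (-(1 / 3 : ℝ))),
                    (∫⁻ z, ENNReal.ofReal (((N : ℝ) + 1)⁻¹ *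
                        (Φ N).collisionSum (Set.Ioc s s')
                          (fun col => max (‖col.postVel.1‖ ^ 4 + ‖col.postVel.2‖ ^ 4
                            - ‖col.preVel.1‖ ^ 4 - ‖col.preVel.2‖ ^ 4) 0 / 2) z)
                      ∂(localGibbsLaw σ a₀ u₀ θ₀ N (Φ N)))
                    ≤ ENNReal.ofReal D + ENNReal.ofReal η *
                        ⨆ r ∈ Set.Icc s s',
                          (∫⁻ z, ENNReal.ofReal (((N : ℝ) + 1)⁻¹ *
                              ∑ i : Fin (N + 1), ‖((Φ N).flow r z i).2‖ ^ 4)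
                            ∂(localGibbsLaw σ a₀ u₀ θ₀ N (Φ N))) :=
  -- DERIVED (lead 1 reshape): S2 := S2b Q0 S2a; its open content is S2a.
  stub_gainCeiling_of_energyFluxCeiling stub_quarticData stub_energyFluxCeiling

-- (seat c6 reshape A: the c5 stub QMF₄ `stub_quarticMixingFloor4` — all windows — is RETIRED in favour of
--  QMF₄ᴸ `stub_quarticMixingFloor4L` below; its statement survives as the hypothesis type of the landed LIF₄″
--  `stub_lossIntensityFloor4_of_mixingFlux4` and of `stub_quarticMixingFloor4L_of_mixingFloor4`.)

/-- **Stub QMF₄ᴸ — THE LAGGED KINETIC-WINDOW QUARTIC MIXING FLOOR (seat c6 reshape A, 2026-08-17; OPEN,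
crux-strength; the line's canonical LOWER primitive, replacing QMF₄).**  Along the flow from local Gibbs data,
for every horizon `T > 0` and flow family there are a threshold `K₀ ≥ 0`, a rate `c > 0` and `N₀` such that
for `N ≥ N₀`, `h_N := (N+1)^{-1/3}` and every window start `s ≥ 0` with `s + h_N ≤ T`:
`c·σ²(N+1)^{1/3} · ∫_s^{s+h_N/2} E[(N+1)⁻¹ Σ_{i : ‖vᵢ(τ)‖ > K₀} ‖vᵢ(τ)‖⁴] dτ
   ≤ E[Σ_{collisions in (s, s+h_N]} Σ_{ordered contact pairs (i,j)} 𝟙{‖vᵢ⁻‖ > K₀} (N+1)⁻¹ · 2‖vᵢ⁺‖²‖vⱼ⁺‖²]`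
— ONE kinetic window of mixing collisions pays for the ‖v‖⁴-content of the lab-fast spheres seen during its
FIRST HALF.  WHY THE RESHAPE (seat c6): QMF₄ (seat c5; the same inequality for ALL windows `0 ≤ s ≤ t ≤ T`,
left side over the whole window) forces, letting `t ↓ s`, an INSTANTANEOUS floor on the mark-weighted contact
intensity of `λ_s` at a.e. time — a statement about the pair structure of the evolved law AT CONTACT (scale
`ε_N`).  Its only consumer never uses that: S1-glue₄ calls LIF₄ at `s′ = s + h_N` only, and LIF₄″ is
window-by-window.  QMF₄ᴸ is implied by QMF₄ (`stub_quarticMixingFloor4L_of_mixingFloor4`, trivial) and NOT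
conversely; it is what the sure first-free-flight-partner kinematics over a short sub-window `τ′h_N` plus
anchor averaging over `r ∈ (s, s+h_N/2]` produce from a STATIC MESOSCOPIC tube-occupation floor under `λ_r`
and a short-window disturbance ceiling (reshape B, this seat).  Rung 0 / rung ½ / Galilean–shear data: as
QMF₄ (a fortiori).  WHY IT MIGHT FAIL: only by CORRIDORS — a positive ‖v‖⁴-fraction of the lab-fast spheres
spending a whole kinetic window without any mixing collision under the evolved law (co-moving platoons /
depleted wakes), or energetic encounters dynamically concentrated on the two neutral impact geometries.
History: QMF (c5 cycle 2, sweeping rate `∝ ν‖v‖`, fifth cut-off moment) ⟶ QMF₄ (c5 cycle 3, thermal rate)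
⟶ QMF₄ᴸ (c6). -/
theorem stub_quarticMixingFloor4L :
    ∀ (a₀ θ₀ : T3 → ℝ) (u₀ : T3 → V3), Continuous a₀ → Continuous θ₀ → Continuous u₀ → (∀ x, 0 < a₀ x) → (∀
    x, 0 < θ₀ x) → ∃ σ₀ : ℝ, 0 < σ₀ ∧ ∀ σ : ℝ, 0 < σ → σ < σ₀ → ∀ T : ℝ, 0 < T → ∀ Φ : ((N : ℕ) →
    HardSphereFlow (Torus.geometry (Fin 3)) (hsDiameter σ N) (N + 1)), ∃ K₀ : ℝ, 0 ≤ K₀ ∧ ∃ c : ℝ, 0 < c ∧ ∃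
    N₀ : ℕ, ∀ N : ℕ, N₀ ≤ N → ∀ s : ℝ, 0 ≤ s → s + ((N : ℝ) + 1) ^ (-(1 / 3 : ℝ)) ≤ T → ENNReal.ofReal (c *
    (σ ^ 2 * ((N + 1 : ℕ) : ℝ) ^ ((1 : ℝ) / 3))) * ∫⁻ τ in Set.Ioc s (s + ((N : ℝ) + 1) ^ (-(1 / 3 : ℝ)) /
    2), (∫⁻ z, ENNReal.ofReal (((N + 1 : ℕ) : ℝ)⁻¹ * ∑ i : Fin (N + 1), if K₀ < ‖(((Φ N).flow τ z) i).2‖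
    then ‖(((Φ N).flow τ z) i).2‖ ^ 4 else 0) ∂(localGibbsLaw σ a₀ u₀ θ₀ N (Φ N))) ≤ ∫⁻ z, (∑ᶠ τ ∈
    collisionTimes (Torus.geometry (Fin 3)) (hsDiameter σ N) (fun r => (Φ N).flow r z) ∩ Set.Ioc s (s + ((N
    : ℝ) + 1) ^ (-(1 / 3 : ℝ))), ∑ i : Fin (N + 1), ∑ j : Fin (N + 1), if i = j then (0 : ℝ≥0∞) else
    (contactSet (Torus.geometry (Fin 3)) (N + 1) (hsDiameter σ N) i j).indicator (fun y => if K₀ <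
    ‖((collidePair (Torus.geometry (Fin 3)) i j y) i).2‖ then ENNReal.ofReal (((N + 1 : ℕ) : ℝ)⁻¹ * (2 *
    (‖(y i).2‖ ^ 2 * ‖(y j).2‖ ^ 2))) else 0) ((Φ N).flow τ z)) ∂(localGibbsLaw σ a₀ u₀ θ₀ N (Φ N)) :=
  -- DERIVED (seat c6 reshape B): QMF₄ᴸ := G2 (G1 T I P); open content = T ∧ I (+ S2a″ upstairs).
  stub_quarticMixingFloor4L_of_windowRateFloor
    (stub_windowMixingRateFloor_of_firstPartner stub_firstPartnerFloor stub_firstPartnerDisturbanceCeiling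
      stub_firstPartnerPathwise)

/-- **Stub QMF₄ ⟹ QMF₄ᴸ (sanity glue; seat c6 reshape A; provable now, XS).**  The c5 all-windows floor implies
the lagged kinetic-window floor: apply QMF₄ on `(s, s+h_N]` and shrink the left-hand time integral to the
first half-window (`Set.Ioc s (s+h_N/2) ⊆ Set.Ioc s (s+h_N)`, non-negative integrand).  Records in the ledger
that reshape A is a WEAKENING of the registered lower primitive. -/
theorem stub_quarticMixingFloor4L_of_mixingFloor4 :
    (∀ (a₀ θ₀ : T3 → ℝ) (u₀ : T3 → V3), Continuous a₀ → Continuous θ₀ → Continuous u₀ → (∀ x, 0 < a₀ x) → (∀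
    x, 0 < θ₀ x) → ∃ σ₀ : ℝ, 0 < σ₀ ∧ ∀ σ : ℝ, 0 < σ → σ < σ₀ → ∀ T : ℝ, 0 < T → ∀ Φ : ((N : ℕ) →
    HardSphereFlow (Torus.geometry (Fin 3)) (hsDiameter σ N) (N + 1)), ∃ K₀ : ℝ, 0 ≤ K₀ ∧ ∃ c : ℝ, 0 < c ∧ ∃
    N₀ : ℕ, ∀ N : ℕ, N₀ ≤ N → ∀ s t : ℝ, 0 ≤ s → s ≤ t → t ≤ T → ENNReal.ofReal (c * (σ ^ 2 * ((N + 1 : ℕ) :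
    ℝ) ^ ((1 : ℝ) / 3))) * ∫⁻ τ in Set.Ioc s t, (∫⁻ z, ENNReal.ofReal (((N + 1 : ℕ) : ℝ)⁻¹ * ∑ i : Fin (N +
    1), if K₀ < ‖(((Φ N).flow τ z) i).2‖ then ‖(((Φ N).flow τ z) i).2‖ ^ 4 else 0) ∂(localGibbsLaw σ a₀ u₀
    θ₀ N (Φ N))) ≤ ∫⁻ z, (∑ᶠ τ ∈ collisionTimes (Torus.geometry (Fin 3)) (hsDiameter σ N) (fun r => (Φ
    N).flow r z) ∩ Set.Ioc s t, ∑ i : Fin (N + 1), ∑ j : Fin (N + 1), if i = j then (0 : ℝ≥0∞) else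
    (contactSet (Torus.geometry (Fin 3)) (N + 1) (hsDiameter σ N) i j).indicator (fun y => if K₀ <
    ‖((collidePair (Torus.geometry (Fin 3)) i j y) i).2‖ then ENNReal.ofReal (((N + 1 : ℕ) : ℝ)⁻¹ * (2 *
    (‖(y i).2‖ ^ 2 * ‖(y j).2‖ ^ 2))) else 0) ((Φ N).flow τ z)) ∂(localGibbsLaw σ a₀ u₀ θ₀ N (Φ N))) → ∀ (a₀
    θ₀ : T3 → ℝ) (u₀ : T3 → V3), Continuous a₀ → Continuous θ₀ → Continuous u₀ → (∀ x, 0 < a₀ x) → (∀ x, 0 <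
    θ₀ x) → ∃ σ₀ : ℝ, 0 < σ₀ ∧ ∀ σ : ℝ, 0 < σ → σ < σ₀ → ∀ T : ℝ, 0 < T → ∀ Φ : ((N : ℕ) → HardSphereFlow
    (Torus.geometry (Fin 3)) (hsDiameter σ N) (N + 1)), ∃ K₀ : ℝ, 0 ≤ K₀ ∧ ∃ c : ℝ, 0 < c ∧ ∃ N₀ : ℕ, ∀ N :
    ℕ, N₀ ≤ N → ∀ s : ℝ, 0 ≤ s → s + ((N : ℝ) + 1) ^ (-(1 / 3 : ℝ)) ≤ T → ENNReal.ofReal (c * (σ ^ 2 * ((N +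
    1 : ℕ) : ℝ) ^ ((1 : ℝ) / 3))) * ∫⁻ τ in Set.Ioc s (s + ((N : ℝ) + 1) ^ (-(1 / 3 : ℝ)) / 2), (∫⁻ z,
    ENNReal.ofReal (((N + 1 : ℕ) : ℝ)⁻¹ * ∑ i : Fin (N + 1), if K₀ < ‖(((Φ N).flow τ z) i).2‖ then ‖(((Φ
    N).flow τ z) i).2‖ ^ 4 else 0) ∂(localGibbsLaw σ a₀ u₀ θ₀ N (Φ N))) ≤ ∫⁻ z, (∑ᶠ τ ∈ collisionTimes
    (Torus.geometry (Fin 3)) (hsDiameter σ N) (fun r => (Φ N).flow r z) ∩ Set.Ioc s (s + ((N : ℝ) + 1) ^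
    (-(1 / 3 : ℝ))), ∑ i : Fin (N + 1), ∑ j : Fin (N + 1), if i = j then (0 : ℝ≥0∞) else (contactSet
    (Torus.geometry (Fin 3)) (N + 1) (hsDiameter σ N) i j).indicator (fun y => if K₀ < ‖((collidePair
    (Torus.geometry (Fin 3)) i j y) i).2‖ then ENNReal.ofReal (((N + 1 : ℕ) : ℝ)⁻¹ * (2 * (‖(y i).2‖ ^ 2 *
    ‖(y j).2‖ ^ 2))) else 0) ((Φ N).flow τ z)) ∂(localGibbsLaw σ a₀ u₀ θ₀ N (Φ N)) :=
  -- CLOSED (seat c6 wave 1): `…Theorems.QuarticSchurLedger.stub_quarticMixingFloor4L_of_mixingFloor4`, p146685.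
  Summit.AtomisticToContinuum.HydrodynamicLimit.Theorems.QuarticSchurLedger.stub_quarticMixingFloor4L_of_mixingFloor4

/-- **Stub LIF₄ᴸ-glue — THE LAGGED KINETIC-WINDOW LOSS-INTENSITY FLOOR FROM QMF₄ᴸ AND THE FLUX CEILING
(glue; seat c6 reshape A; provable now, S–M: the landed LIF₄″
`…Theorems.QuarticSchurLedger.stub_lossIntensityFloor4_of_mixingFlux4`, p142596, restricted to the window
`(s, s+h_N]`, `h_N = (N+1)^{-1/3}`, with the left-hand time integral over the first half-window only — the
left side is only carried through; S2a″ is used on `(s, s+h_N]`).**  `QMF₄ᴸ → S2a″ → LIF₄ᴸ`: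
`δν∫_s^{s+h_N/2} M₄^{>K₀} ≤ Loss(s, s+h_N] + Cν·h_N·sup_{[s,s+h_N]} m₂·sup m₃`, `δ := c/2`, `C := C_{S2a″}`. -/
theorem stub_lossIntensityFloor4L_of_mixingFlux4L :
    (∀ (a₀ θ₀ : T3 → ℝ) (u₀ : T3 → V3), Continuous a₀ → Continuous θ₀ → Continuous u₀ → (∀ x, 0 < a₀ x) → (∀
    x, 0 < θ₀ x) → ∃ σ₀ : ℝ, 0 < σ₀ ∧ ∀ σ : ℝ, 0 < σ → σ < σ₀ → ∀ T : ℝ, 0 < T → ∀ Φ : ((N : ℕ) →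
    HardSphereFlow (Torus.geometry (Fin 3)) (hsDiameter σ N) (N + 1)), ∃ K₀ : ℝ, 0 ≤ K₀ ∧ ∃ c : ℝ, 0 < c ∧ ∃
    N₀ : ℕ, ∀ N : ℕ, N₀ ≤ N → ∀ s : ℝ, 0 ≤ s → s + ((N : ℝ) + 1) ^ (-(1 / 3 : ℝ)) ≤ T → ENNReal.ofReal (c *
    (σ ^ 2 * ((N + 1 : ℕ) : ℝ) ^ ((1 : ℝ) / 3))) * ∫⁻ τ in Set.Ioc s (s + ((N : ℝ) + 1) ^ (-(1 / 3 : ℝ)) /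
    2), (∫⁻ z, ENNReal.ofReal (((N + 1 : ℕ) : ℝ)⁻¹ * ∑ i : Fin (N + 1), if K₀ < ‖(((Φ N).flow τ z) i).2‖
    then ‖(((Φ N).flow τ z) i).2‖ ^ 4 else 0) ∂(localGibbsLaw σ a₀ u₀ θ₀ N (Φ N))) ≤ ∫⁻ z, (∑ᶠ τ ∈
    collisionTimes (Torus.geometry (Fin 3)) (hsDiameter σ N) (fun r => (Φ N).flow r z) ∩ Set.Ioc s (s + ((N
    : ℝ) + 1) ^ (-(1 / 3 : ℝ))), ∑ i : Fin (N + 1), ∑ j : Fin (N + 1), if i = j then (0 : ℝ≥0∞) else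
    (contactSet (Torus.geometry (Fin 3)) (N + 1) (hsDiameter σ N) i j).indicator (fun y => if K₀ <
    ‖((collidePair (Torus.geometry (Fin 3)) i j y) i).2‖ then ENNReal.ofReal (((N + 1 : ℕ) : ℝ)⁻¹ * (2 *
    (‖(y i).2‖ ^ 2 * ‖(y j).2‖ ^ 2))) else 0) ((Φ N).flow τ z)) ∂(localGibbsLaw σ a₀ u₀ θ₀ N (Φ N))) → (∀
    (a₀ θ₀ : T3 → ℝ) (u₀ : T3 → V3), Continuous a₀ → Continuous θ₀ → Continuous u₀ → (∀ x, 0 < a₀ x) → (∀ x,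
    0 < θ₀ x) → ∃ σ₀ : ℝ, 0 < σ₀ ∧ ∀ σ : ℝ, 0 < σ → σ < σ₀ → ∀ T : ℝ, 0 < T → ∀ Φ : ((N : ℕ) →
    HardSphereFlow (Torus.geometry (Fin 3)) (hsDiameter σ N) (N + 1)), ∃ C : ℝ, 0 ≤ C ∧ ∃ N₀ : ℕ, ∀ N : ℕ,
    N₀ ≤ N → ∀ s s' : ℝ, 0 ≤ s → s ≤ s' → s' ≤ T → (∫⁻ z, ENNReal.ofReal (((N : ℝ) + 1)⁻¹ * (Φ
    N).collisionSum (Set.Ioc s s') (fun col => ‖col.preVel.1‖ ^ 2 * ‖col.preVel.2‖ ^ 2) z) ∂(localGibbsLaw σ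
    a₀ u₀ θ₀ N (Φ N))) ≤ ENNReal.ofReal (C * (σ ^ 2 * ((N : ℝ) + 1) ^ (1 / 3 : ℝ) * (s' - s))) * (⨆ r ∈
    Set.Icc s s', (∫⁻ z, ENNReal.ofReal (((N : ℝ) + 1)⁻¹ * ∑ i : Fin (N + 1), ‖((Φ N).flow r z i).2‖ ^ 2)
    ∂(localGibbsLaw σ a₀ u₀ θ₀ N (Φ N)))) * (⨆ r ∈ Set.Icc s s', (∫⁻ z, ENNReal.ofReal (((N : ℝ) + 1)⁻¹ * ∑
    i : Fin (N + 1), ‖((Φ N).flow r z i).2‖ ^ 3) ∂(localGibbsLaw σ a₀ u₀ θ₀ N (Φ N))))) → ∀ (a₀ θ₀ : T3 → ℝ)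
    (u₀ : T3 → V3), Continuous a₀ → Continuous θ₀ → Continuous u₀ → (∀ x, 0 < a₀ x) → (∀ x, 0 < θ₀ x) → ∃ σ₀
    : ℝ, 0 < σ₀ ∧ ∀ σ : ℝ, 0 < σ → σ < σ₀ → ∀ T : ℝ, 0 < T → ∀ Φ : ((N : ℕ) → HardSphereFlow (Torus.geometry
    (Fin 3)) (hsDiameter σ N) (N + 1)), ∃ δ : ℝ, 0 < δ ∧ ∃ K₀ : ℝ, 0 ≤ K₀ ∧ ∃ C : ℝ, 0 ≤ C ∧ ∃ N₀ : ℕ, ∀ N :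
    ℕ, N₀ ≤ N → ∀ s : ℝ, 0 ≤ s → s + ((N : ℝ) + 1) ^ (-(1 / 3 : ℝ)) ≤ T → ENNReal.ofReal (δ * (σ ^ 2 * ((N :
    ℝ) + 1) ^ (1 / 3 : ℝ))) * (∫⁻ r in Set.Ioc s (s + ((N : ℝ) + 1) ^ (-(1 / 3 : ℝ)) / 2), (∫⁻ z,
    ENNReal.ofReal (((N : ℝ) + 1)⁻¹ * ∑ i : Fin (N + 1), (if K₀ < ‖((Φ N).flow r z i).2‖ then ‖((Φ N).flow r
    z i).2‖ ^ 4 else 0)) ∂(localGibbsLaw σ a₀ u₀ θ₀ N (Φ N)))) ≤ (∫⁻ z, ENNReal.ofReal (((N : ℝ) + 1)⁻¹ * (Φ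
    N).collisionSum (Set.Ioc s (s + ((N : ℝ) + 1) ^ (-(1 / 3 : ℝ)))) (fun col => max (‖col.preVel.1‖ ^ 4 +
    ‖col.preVel.2‖ ^ 4 - ‖col.postVel.1‖ ^ 4 - ‖col.postVel.2‖ ^ 4) 0 / 2) z) ∂(localGibbsLaw σ a₀ u₀ θ₀ N
    (Φ N))) + ENNReal.ofReal (C * (σ ^ 2 * ((N : ℝ) + 1) ^ (1 / 3 : ℝ) * (s + ((N : ℝ) + 1) ^ (-(1 / 3 : ℝ))
    - s))) * (⨆ r ∈ Set.Icc s (s + ((N : ℝ) + 1) ^ (-(1 / 3 : ℝ))), (∫⁻ z, ENNReal.ofReal (((N : ℝ) + 1)⁻¹ *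
    ∑ i : Fin (N + 1), ‖((Φ N).flow r z i).2‖ ^ 2) ∂(localGibbsLaw σ a₀ u₀ θ₀ N (Φ N)))) * (⨆ r ∈ Set.Icc s
    (s + ((N : ℝ) + 1) ^ (-(1 / 3 : ℝ))), (∫⁻ z, ENNReal.ofReal (((N : ℝ) + 1)⁻¹ * ∑ i : Fin (N + 1), ‖((Φ
    N).flow r z i).2‖ ^ 3) ∂(localGibbsLaw σ a₀ u₀ θ₀ N (Φ N)))) :=
  -- CLOSED (seat c6 wave 1): `…Theorems.QuarticSchurLedger.stub_lossIntensityFloor4L_of_mixingFlux4L`, p146758.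
  Summit.AtomisticToContinuum.HydrodynamicLimit.Theorems.QuarticSchurLedger.stub_lossIntensityFloor4L_of_mixingFlux4L

/-- **Stub S1-glue₄ᴸ — THE LOSS FLOOR FROM THE LAGGED KINETIC-WINDOW LOSS-INTENSITY FLOOR (glue; seat c6
reshape A; provable now, M: the landed S1-glue₄ `…Theorems.QuarticSchurLedger.stub_lossFloor_of_lossIntensityFloor4`,
p143051, re-run with LIF₄ᴸ).**  `S2 → LIF₄ᴸ → S1`: window `h = (N+1)^{-1/3}` (`τ = 1`), horizon `t + 2` in
LIF₄ᴸ; WF₄ (`stub_windowQuarticFloor4`, landed p142204) on the HALF window `(s, s+h/2]` gives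
`(h/2)·y(s) ≤ ∫_s^{s+h/2} M₄^{>K₀} + (h/2)K₀⁴ + (h/2)·Loss(s, s+h/2]`; multiply by `δν_N` (`δν_N h/2 = δσ²/2`),
use LIF₄ᴸ and the monotonicity `Loss(s, s+h/2] ≤ Loss(s, s+h]` (non-negative marks, window inclusion, on the
good set): `κ₀ y(s) ≤ (1+κ₀) Loss(s,s+h] + κ₀K₀⁴ + Cσ² sup m₂ sup m₃` with `κ₀ = δσ²/2`; from here the landed
abstract lemmas `lossFloorGlue_core/_ennreal/_real/_div` and the S2/Q0 bookkeeping apply VERBATIM (δ ↦ δ/2). -/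
theorem stub_lossFloor_of_lossIntensityFloor4L :
    (∀ (a₀ θ₀ : T3 → ℝ) (u₀ : T3 → V3), Continuous a₀ → Continuous θ₀ → Continuous u₀ → (∀ x, 0 < a₀ x) → (∀
    x, 0 < θ₀ x) → ∃ σ₀ : ℝ, 0 < σ₀ ∧ ∀ σ : ℝ, 0 < σ → σ < σ₀ → ∀ (T : ℝ) (ρ θ : ℝ → T3 → ℝ) (u : ℝ → T3 →
    V3), IsHardSphereEulerSolution σ T ρ u θ → ∀ Φ : (N : ℕ) → HardSphereFlow (Torus.geometry (Fin 3))
    (hsDiameter σ N) (N + 1), TendstoHydroFieldsAt (fun N => localGibbsLaw σ a₀ u₀ θ₀ N (Φ N)) Φ ρ u θ 0 → ∀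
    t ∈ Set.Ico 0 T, ∀ τ : ℝ, 0 < τ → ∀ η : ℝ, 0 < η → ∃ D : ℝ, 0 ≤ D ∧ ∃ N₀ : ℕ, ∀ N : ℕ, N₀ ≤ N → ∀ s ∈
    Set.Icc 0 t, ∀ s' ∈ Set.Icc s (s + τ * ((N : ℝ) + 1) ^ (-(1 / 3 : ℝ))), (∫⁻ z, ENNReal.ofReal (((N : ℝ)
    + 1)⁻¹ * (Φ N).collisionSum (Set.Ioc s s') (fun col => max (‖col.postVel.1‖ ^ 4 + ‖col.postVel.2‖ ^ 4 -
    ‖col.preVel.1‖ ^ 4 - ‖col.preVel.2‖ ^ 4) 0 / 2) z) ∂(localGibbsLaw σ a₀ u₀ θ₀ N (Φ N))) ≤ ENNReal.ofReal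
    D + ENNReal.ofReal η * ⨆ r ∈ Set.Icc s s', (∫⁻ z, ENNReal.ofReal (((N : ℝ) + 1)⁻¹ * ∑ i : Fin (N + 1),
    ‖((Φ N).flow r z i).2‖ ^ 4) ∂(localGibbsLaw σ a₀ u₀ θ₀ N (Φ N)))) → (∀ (a₀ θ₀ : T3 → ℝ) (u₀ : T3 → V3),
    Continuous a₀ → Continuous θ₀ → Continuous u₀ → (∀ x, 0 < a₀ x) → (∀ x, 0 < θ₀ x) → ∃ σ₀ : ℝ, 0 < σ₀ ∧ ∀
    σ : ℝ, 0 < σ → σ < σ₀ → ∀ T : ℝ, 0 < T → ∀ Φ : ((N : ℕ) → HardSphereFlow (Torus.geometry (Fin 3))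
    (hsDiameter σ N) (N + 1)), ∃ δ : ℝ, 0 < δ ∧ ∃ K₀ : ℝ, 0 ≤ K₀ ∧ ∃ C : ℝ, 0 ≤ C ∧ ∃ N₀ : ℕ, ∀ N : ℕ, N₀ ≤
    N → ∀ s : ℝ, 0 ≤ s → s + ((N : ℝ) + 1) ^ (-(1 / 3 : ℝ)) ≤ T → ENNReal.ofReal (δ * (σ ^ 2 * ((N : ℝ) + 1)
    ^ (1 / 3 : ℝ))) * (∫⁻ r in Set.Ioc s (s + ((N : ℝ) + 1) ^ (-(1 / 3 : ℝ)) / 2), (∫⁻ z, ENNReal.ofReal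
    (((N : ℝ) + 1)⁻¹ * ∑ i : Fin (N + 1), (if K₀ < ‖((Φ N).flow r z i).2‖ then ‖((Φ N).flow r z i).2‖ ^ 4
    else 0)) ∂(localGibbsLaw σ a₀ u₀ θ₀ N (Φ N)))) ≤ (∫⁻ z, ENNReal.ofReal (((N : ℝ) + 1)⁻¹ * (Φ
    N).collisionSum (Set.Ioc s (s + ((N : ℝ) + 1) ^ (-(1 / 3 : ℝ)))) (fun col => max (‖col.preVel.1‖ ^ 4 +
    ‖col.preVel.2‖ ^ 4 - ‖col.postVel.1‖ ^ 4 - ‖col.postVel.2‖ ^ 4) 0 / 2) z) ∂(localGibbsLaw σ a₀ u₀ θ₀ N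
    (Φ N))) + ENNReal.ofReal (C * (σ ^ 2 * ((N : ℝ) + 1) ^ (1 / 3 : ℝ) * (s + ((N : ℝ) + 1) ^ (-(1 / 3 : ℝ))
    - s))) * (⨆ r ∈ Set.Icc s (s + ((N : ℝ) + 1) ^ (-(1 / 3 : ℝ))), (∫⁻ z, ENNReal.ofReal (((N : ℝ) + 1)⁻¹ *
    ∑ i : Fin (N + 1), ‖((Φ N).flow r z i).2‖ ^ 2) ∂(localGibbsLaw σ a₀ u₀ θ₀ N (Φ N)))) * (⨆ r ∈ Set.Icc s
    (s + ((N : ℝ) + 1) ^ (-(1 / 3 : ℝ))), (∫⁻ z, ENNReal.ofReal (((N : ℝ) + 1)⁻¹ * ∑ i : Fin (N + 1), ‖((Φ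
    N).flow r z i).2‖ ^ 3) ∂(localGibbsLaw σ a₀ u₀ θ₀ N (Φ N))))) → (∀ (a₀ θ₀ : T3 → ℝ) (u₀ : T3 → V3),
    Continuous a₀ → Continuous θ₀ → Continuous u₀ → (∀ x, 0 < a₀ x) → (∀ x, 0 < θ₀ x) → ∃ σ₀ : ℝ, 0 < σ₀ ∧ ∀
    σ : ℝ, 0 < σ → σ < σ₀ → ∀ (T : ℝ) (ρ θ : ℝ → T3 → ℝ) (u : ℝ → T3 → V3), IsHardSphereEulerSolution σ T ρ
    u θ → ∀ Φ : (N : ℕ) → HardSphereFlow (Torus.geometry (Fin 3)) (hsDiameter σ N) (N + 1),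
    TendstoHydroFieldsAt (fun N => localGibbsLaw σ a₀ u₀ θ₀ N (Φ N)) Φ ρ u θ 0 → ∀ t ∈ Set.Ico 0 T, ∃ τ : ℝ,
    0 < τ ∧ ∃ c : ℝ, 0 < c ∧ c ≤ 1 ∧ ∃ A : ℝ, 0 ≤ A ∧ ∃ N₀ : ℕ, ∀ N : ℕ, N₀ ≤ N → ∀ s ∈ Set.Icc 0 t,
    ENNReal.ofReal c * (∫⁻ z, ENNReal.ofReal (((N : ℝ) + 1)⁻¹ * ∑ i : Fin (N + 1), ‖((Φ N).flow s z i).2‖ ^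
    4) ∂(localGibbsLaw σ a₀ u₀ θ₀ N (Φ N))) ≤ ENNReal.ofReal (c * A) + (∫⁻ z, ENNReal.ofReal (((N : ℝ) +
    1)⁻¹ * (Φ N).collisionSum (Set.Ioc s (s + τ * ((N : ℝ) + 1) ^ (-(1 / 3 : ℝ)))) (fun col => max
    (‖col.preVel.1‖ ^ 4 + ‖col.preVel.2‖ ^ 4 - ‖col.postVel.1‖ ^ 4 - ‖col.postVel.2‖ ^ 4) 0 / 2) z)
    ∂(localGibbsLaw σ a₀ u₀ θ₀ N (Φ N)))) :=
  -- CLOSED (seat c6 wave 1): `…Theorems.QuarticSchurLedger.stub_lossFloor_of_lossIntensityFloor4L`, p146878.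
  Summit.AtomisticToContinuum.HydrodynamicLimit.Theorems.QuarticSchurLedger.stub_lossFloor_of_lossIntensityFloor4L

/-- **Stub S1 — THE WINDOW LOSS FLOOR (crux-strength; the hardest stub; DERIVED: seat a1 from RF ∧ SD ∧ CID, seat c5 (after the CID kill) from RF₂ ∧ SD ∧ S2a″, see the reshape stubs above).**  In the frame of the crux,
for every `t < T` there are a window length `τ > 0`, a fraction `0 < c ≤ 1`, a level `A ≥ 0` and `N₀`
such that for `N ≥ N₀` and every window start `s ∈ [0,t]`:
`c · y_N(s) ≤ c · A + Loss_N(s, s + τ(N+1)^{-1/3}]`,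
i.e. the expected quartic LOSS over one window of `τ` bath mean free times is at least the fraction
`c` of the quartic content present at the window start above the level `A`.  Intended proof shape
(the card's S1, weakened from the tail form `Loss ≥ c·E[(N+1)⁻¹∑ᵢ‖vᵢ(s)‖⁴𝟙{‖vᵢ(s)‖² > K₀Θ}]`, which
implies this with `A = (K₀Θ)²`, `Θ ≥ sup_{x, r ≤ t+1} θ(r,x)` finite pre-shock): a particle with
`‖v‖² > K₀Θ` makes `≍ τσ²‖v‖ ≫ 1` encounters per window and loses `2cos²ψ sin²ψ‖v‖⁴ + O(Θ‖v‖²)` per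
encounter with a thermal partner (`quartic_collision_identity`; flux-uniform mean `‖v‖⁴/3`,
`quartic_collision_nonpos_of_target_normal_rest`), so a fixed fraction is dissipated unless energetic
particles see δ-NEUTRAL geometry (graze `cos²ψ < δ` OR dead-centre hop `cos²ψ > 1 − δ`, the latter a
pure carrier change, triage r1-3 `deadCentre_swap`) in all but a vanishing fraction of encounters, or
sit in a Θ-hot mesoscopic ball.  LEANS ON (declared, not typed here): the MESOSCOPIC TEMPERATURE CAP
S0 (w.h.p. every `(N+1)^{-γ}`-ball has kinetic energy per particle `≤ Θ` for `s ≤ t`; a second open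
a-priori input which `H_N(t) = o(N)` does NOT supply, triage r1-1 (ii) / r1-3) and a MULTIPLICATIVE
fast-sphere encounter-rate floor (not the typed additive `RateFloor` stmt-13080, triage r1-1 (i)); the
natural producer in this route is `OneFlightLayeredChaos` (stmt-14535) for energetic projectiles, and
above `M₀(σ) = C₀σ⁻³√Θ` the targets are frozen during a flight (one-flight Lorentz regime, triage r1-3).
WHY IT MIGHT FAIL: an energetic lineage threading δ-neutral encounters for a whole window with
non-vanishing `λ_N`-weight at some `s` (empty corridors cost only `e^{−σ²τ‖v‖}` ≫ `e^{−κN}` in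
entropy, so this is a DYNAMICAL statement — Disproof §5).  Equilibrium-consistent (`A ≥ y(0) = 15θ²`,
invariance).  In print only for Boltzmann/Kac (Mischler–Mouhot 2013). -/
theorem stub_lossFloor :
    ∀ (a₀ θ₀ : T3 → ℝ) (u₀ : T3 → V3), Continuous a₀ → Continuous θ₀ → Continuous u₀ →
      (∀ x, 0 < a₀ x) → (∀ x, 0 < θ₀ x) →
      ∃ σ₀ : ℝ, 0 < σ₀ ∧ ∀ σ : ℝ, 0 < σ → σ < σ₀ →
        ∀ (T : ℝ) (ρ θ : ℝ → T3 → ℝ) (u : ℝ → T3 → V3), IsHardSphereEulerSolution σ T ρ u θ →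
          ∀ Φ : (N : ℕ) → HardSphereFlow (Torus.geometry (Fin 3)) (hsDiameter σ N) (N + 1),
            TendstoHydroFieldsAt (fun N => localGibbsLaw σ a₀ u₀ θ₀ N (Φ N)) Φ ρ u θ 0 →
              ∀ t ∈ Set.Ico 0 T, ∃ τ : ℝ, 0 < τ ∧ ∃ c : ℝ, 0 < c ∧ c ≤ 1 ∧ ∃ A : ℝ, 0 ≤ A ∧
                ∃ N₀ : ℕ, ∀ N : ℕ, N₀ ≤ N → ∀ s ∈ Set.Icc 0 t,
                  ENNReal.ofReal c *
                      (∫⁻ z, ENNReal.ofReal (((N : ℝ) + 1)⁻¹ *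
                          ∑ i : Fin (N + 1), ‖((Φ N).flow s z i).2‖ ^ 4)
                        ∂(localGibbsLaw σ a₀ u₀ θ₀ N (Φ N)))
                    ≤ ENNReal.ofReal (c * A) +
                      (∫⁻ z, ENNReal.ofReal (((N : ℝ) + 1)⁻¹ *
                          (Φ N).collisionSum (Set.Ioc s (s + τ * ((N : ℝ) + 1) ^ (-(1 / 3 : ℝ))))
                            (fun col => max (‖col.preVel.1‖ ^ 4 + ‖col.preVel.2‖ ^ 4
                              - ‖col.postVel.1‖ ^ 4 - ‖col.postVel.2‖ ^ 4) 0 / 2) z)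
                        ∂(localGibbsLaw σ a₀ u₀ θ₀ N (Φ N))) :=
  -- DERIVED (seat c5): cycle 1 S1 := S1-glue S2 Q0 (LIF′ RF₂ SD S2a″) WF; cycle 2 S1 := S1-glue S2 Q0 (LIF″ QMF S2a″) WF;
  -- cycle 3 S1 := S1-glue₄ S2 Q0 (LIF₄″ QMF₄ S2a″) WF₄; open content = QMF₄ ∧ S2a″.
  -- seat c6 reshape A: S1 := S1-glue₄ᴸ S2 (LIF₄ᴸ-glue QMF₄ᴸ S2a″); open content = QMF₄ᴸ ∧ S2a″.
  stub_lossFloor_of_lossIntensityFloor4L stub_gainCeiling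
    (stub_lossIntensityFloor4L_of_mixingFlux4L stub_quarticMixingFloor4L stub_energyFluxCeilingWindows)

/-! ### Landed record (seat c6: blocks removed from this workfile for size — all LANDED in the tree, namespace
`Summit.AtomisticToContinuum.HydrodynamicLimit.Theorems.QuarticSchurLedger` unless stated)
* WF `stub_windowQuarticFloor` p126563 · S1-glue `stub_lossFloor_of_lossIntensityFloor` p126987 · LIF′ `stub_lossIntensityFloor_of_rateSplitFlux` p140393
* QMF `stub_quarticMixingFloor` (c5 cycle 2, superseded by QMF₄ then QMF₄ᴸ; statement = hypothesis type of LIF″) · LIF″ `stub_lossIntensityFloor_of_mixingFlux` p140830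
* LIF₄″ `stub_lossIntensityFloor4_of_mixingFlux4` p142596 · WF₄ `stub_windowQuarticFloor4` p142204 · S1-glue₄ `stub_lossFloor_of_lossIntensityFloor4` p143051
* rung-0 audits: `stub_quarticMixingFloorRung0` p141930 · `stub_quarticMixingFloor4Rung0` p143608 · `stub_quarticSplitDeficitRung0` p140148 · `stub_fastCollisionRateQuarticRung0` p135746
* RF ⟹ RF₂ `fastCollisionRateQuartic_of_fastParticleCollisionRate` (c5; cone of `…EnergyCurrentTailsSplit.lean`)
-/

end Holds

/-! ## §2 Stub statements by name (D-0027 §3.3) -/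

/-- Statement of stub L (`Holds.stub_quarticLedger`), by name. -/
def stub_quarticLedger : Prop := type_of% Holds.stub_quarticLedger
/-- Statement of stub Q0 (`Holds.stub_quarticData`), by name. -/
def stub_quarticData : Prop := type_of% Holds.stub_quarticData
/-- Statement of stub S1 (`Holds.stub_lossFloor`), by name — DERIVED (RF₂ ∧ SD ∧ S2a″ + landed glue). -/
def stub_lossFloor : Prop := type_of% Holds.stub_lossFloor
/-- Statement of stub S2 (`Holds.stub_gainCeiling`), by name (DERIVED from S2a, S2b, Q0). -/
def stub_gainCeiling : Prop := type_of% Holds.stub_gainCeiling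
/-- Statement of stub S2a (`Holds.stub_energyFluxCeiling`), by name — DERIVED from S2a″. -/
def stub_energyFluxCeiling : Prop := type_of% Holds.stub_energyFluxCeiling
/-- Statement of stub S2b (`Holds.stub_gainCeiling_of_energyFluxCeiling`), by name — landed glue. -/
def stub_gainCeiling_of_energyFluxCeiling : Prop := type_of% Holds.stub_gainCeiling_of_energyFluxCeiling
/-- Statement of stub S2a″ (`Holds.stub_energyFluxCeilingWindows`), by name — OPEN primitive (upper). -/
def stub_energyFluxCeilingWindows : Prop := type_of% Holds.stub_energyFluxCeilingWindows
/-- Statement of the dock S2a ⟸ S2a″ (`Holds.stub_energyFluxCeiling_of_windows`), by name — glue. -/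
def stub_energyFluxCeiling_of_windows : Prop := type_of% Holds.stub_energyFluxCeiling_of_windows
/-- Statement of the dock S2a″ ⟸ stmt-16939 (`Holds.stub_energyFluxCeilingWindows_of_oneRare`), by name — glue. -/
def stub_energyFluxCeilingWindows_of_oneRare : Prop := type_of% Holds.stub_energyFluxCeilingWindows_of_oneRare
/-- Statement of stub QMF₄ᴸ (`Holds.stub_quarticMixingFloor4L`, seat c6 reshape A; OPEN primitive (lower)). -/
def stub_quarticMixingFloor4L : Prop := type_of% Holds.stub_quarticMixingFloor4L
/-- Statement of the sanity glue QMF₄ ⟹ QMF₄ᴸ (`Holds.stub_quarticMixingFloor4L_of_mixingFloor4`, seat c6). -/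
def stub_quarticMixingFloor4L_of_mixingFloor4 : Prop := type_of% Holds.stub_quarticMixingFloor4L_of_mixingFloor4
/-- Statement of the glue LIF₄ᴸ (`Holds.stub_lossIntensityFloor4L_of_mixingFlux4L`, seat c6). -/
def stub_lossIntensityFloor4L_of_mixingFlux4L : Prop := type_of% Holds.stub_lossIntensityFloor4L_of_mixingFlux4L
/-- Statement of the glue S1-glue₄ᴸ (`Holds.stub_lossFloor_of_lossIntensityFloor4L`, seat c6). -/
def stub_lossFloor_of_lossIntensityFloor4L : Prop := type_of% Holds.stub_lossFloor_of_lossIntensityFloor4L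
/-- Statement of stub T (`Holds.stub_firstPartnerFloor`, seat c6 reshape B; OPEN primitive (lower, static)). -/
def stub_firstPartnerFloor : Prop := type_of% Holds.stub_firstPartnerFloor
/-- Statement of stub I (`Holds.stub_firstPartnerDisturbanceCeiling`, seat c6 reshape B; OPEN primitive (ceiling)). -/
def stub_firstPartnerDisturbanceCeiling : Prop := type_of% Holds.stub_firstPartnerDisturbanceCeiling
/-- Statement of stub P (`Holds.stub_firstPartnerPathwise`, seat c6 reshape B; glue, sure kinematics). -/
def stub_firstPartnerPathwise : Prop := type_of% Holds.stub_firstPartnerPathwise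
/-- Statement of glue G1 (`Holds.stub_windowMixingRateFloor_of_firstPartner`, seat c6 reshape B). -/
def stub_windowMixingRateFloor_of_firstPartner : Prop := type_of% Holds.stub_windowMixingRateFloor_of_firstPartner
/-- Statement of glue G2 (`Holds.stub_quarticMixingFloor4L_of_windowRateFloor`, seat c6 reshape B). -/
def stub_quarticMixingFloor4L_of_windowRateFloor : Prop := type_of% Holds.stub_quarticMixingFloor4L_of_windowRateFloor
/-! ## §3 The absorbing one-window recursion (proved; pure bookkeeping on `ℝ≥0∞`-valued functions) -/

/-- The ceiling of the quartic maximum principle: `2 (max B (2A + 4D/c) + D)`. -/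
def quarticCeiling (c A D B : ℝ) : ℝ := 2 * (max B (2 * A + 4 * D / c) + D)

/-- **The absorbing one-window recursion (the glue of the line, sorry-free).**  Let `y ≥ 0` (a
content) and `G, L ≥ 0` (window gain and loss) satisfy the exact ledger `y s′ + L(s,s′) = y s + G(s,s′)`
(`0 ≤ s ≤ s′`), the LOSS FLOOR `c·y s ≤ c·A + L(s, s+h)` and the SUB-LINEAR GAIN
`G(s,s′) ≤ D + η·sup_{[s,s′]} y` (`s′ ≤ s + h`) for window starts `s ∈ [0,t]`, with `0 < c ≤ 1`,
`0 ≤ η ≤ c/4`, a crude a-priori bound `y ≤ B′` and the initial bound `y 0 ≤ B`.  Then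
`y s ≤ 2 (max B (2A + 4D/c) + D)` for every `s ∈ [0,t]` — a bound in which neither the window `h`, nor
the crude bound `B′`, nor the number of windows `t/h` appears (this is where the collision clock
cancels).  Steps: `sup_{[s,s+h]} y ≤ 2(y s + D)`; `y(s+h) ≤ (1 − c/2) y s + cA + 2D`; induction over
`kh ≤ t`; every `s ≤ t` lies in the window of `⌊s/h⌋h`. -/
theorem absorbing_recursion {y : ℝ → ℝ≥0∞} {G L : ℝ → ℝ → ℝ≥0∞} {t h c A D η B B' : ℝ}
    (hh : 0 < h) (hc : 0 < c) (hc1 : c ≤ 1) (hA : 0 ≤ A) (hD : 0 ≤ D) (hη : 0 ≤ η)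
    (hηc : η ≤ c / 4) (hB : 0 ≤ B)
    (hbdd : ∀ r, y r ≤ ENNReal.ofReal B')
    (h0 : y 0 ≤ ENNReal.ofReal B)
    (hled : ∀ s s', 0 ≤ s → s ≤ s' → y s' + L s s' = y s + G s s')
    (hloss : ∀ s ∈ Icc 0 t, ENNReal.ofReal c * y s ≤ ENNReal.ofReal (c * A) + L s (s + h))
    (hgain : ∀ s ∈ Icc 0 t, ∀ s' ∈ Icc s (s + h),
      G s s' ≤ ENNReal.ofReal D + ENNReal.ofReal η * ⨆ r ∈ Icc s s', y r) :
    ∀ s ∈ Icc 0 t, y s ≤ ENNReal.ofReal (quarticCeiling c A D B) := by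
  -- Step 0: finiteness and the real-valued copies.
  set B'' : ℝ := max B' 0 with hB''
  have hbdd' : ∀ r, y r ≤ ENNReal.ofReal B'' := fun r =>
    (hbdd r).trans (ENNReal.ofReal_le_ofReal (le_max_left _ _))
  have hy_ne : ∀ r, y r ≠ ⊤ := fun r => ne_top_of_le_ne_top ENNReal.ofReal_ne_top (hbdd' r)
  set yR : ℝ → ℝ := fun r => (y r).toReal with hyR
  have hy_eq : ∀ r, y r = ENNReal.ofReal (yR r) := fun r => (ENNReal.ofReal_toReal (hy_ne r)).symm
  have hyR_nn : ∀ r, 0 ≤ yR r := fun r => ENNReal.toReal_nonneg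
  -- window suprema
  set S : ℝ → ℝ≥0∞ := fun s => ⨆ r ∈ Icc s (s + h), y r with hS
  have hS_le : ∀ s, S s ≤ ENNReal.ofReal B'' := fun s => iSup₂_le fun r _ => hbdd' r
  have hS_ne : ∀ s, S s ≠ ⊤ := fun s => ne_top_of_le_ne_top ENNReal.ofReal_ne_top (hS_le s)
  have hy_le_S : ∀ s, ∀ r ∈ Icc s (s + h), y r ≤ S s := fun s r hr =>
    le_iSup₂ (f := fun r (_ : r ∈ Icc s (s + h)) => y r) r hr
  set SR : ℝ → ℝ := fun s => (S s).toReal with hSR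
  have hSR_nn : ∀ s, 0 ≤ SR s := fun s => ENNReal.toReal_nonneg
  have hyR_le_SR : ∀ s, ∀ r ∈ Icc s (s + h), yR r ≤ SR s := fun s r hr =>
    (ENNReal.toReal_le_toReal (hy_ne r) (hS_ne s)).2 (hy_le_S s r hr)
  -- gain: finite, and its real form
  have hG_le : ∀ s ∈ Icc 0 t, ∀ s' ∈ Icc s (s + h),
      G s s' ≤ ENNReal.ofReal D + ENNReal.ofReal η * S s := by
    intro s hs s' hs'
    refine (hgain s hs s' hs').trans ?_
    gcongr
    exact biSup_mono fun r hr => ⟨hr.1, hr.2.trans hs'.2⟩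
  have hG_ne : ∀ s ∈ Icc 0 t, ∀ s' ∈ Icc s (s + h), G s s' ≠ ⊤ := by
    intro s hs s' hs'
    refine ne_top_of_le_ne_top ?_ (hG_le s hs s' hs')
    exact ENNReal.add_ne_top.2 ⟨ENNReal.ofReal_ne_top, ENNReal.mul_ne_top ENNReal.ofReal_ne_top (hS_ne s)⟩
  have hGR : ∀ s ∈ Icc 0 t, ∀ s' ∈ Icc s (s + h), (G s s').toReal ≤ D + η * SR s := by
    intro s hs s' hs'
    have h1 := (ENNReal.toReal_le_toReal (hG_ne s hs s' hs')
      (ENNReal.add_ne_top.2 ⟨ENNReal.ofReal_ne_top,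
        ENNReal.mul_ne_top ENNReal.ofReal_ne_top (hS_ne s)⟩)).2 (hG_le s hs s' hs')
    rwa [ENNReal.toReal_add ENNReal.ofReal_ne_top (ENNReal.mul_ne_top ENNReal.ofReal_ne_top (hS_ne s)),
      ENNReal.toReal_mul, ENNReal.toReal_ofReal hD, ENNReal.toReal_ofReal hη] at h1
  -- loss: finite, and the real ledger
  have hL_le : ∀ s s', 0 ≤ s → s ≤ s' → L s s' ≤ y s + G s s' := by
    intro s s' hs0 hss'
    calc L s s' ≤ y s' + L s s' := le_add_self
      _ = y s + G s s' := hled s s' hs0 hss'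
  have hL_ne : ∀ s ∈ Icc 0 t, ∀ s' ∈ Icc s (s + h), L s s' ≠ ⊤ := by
    intro s hs s' hs'
    refine ne_top_of_le_ne_top ?_ (hL_le s s' hs.1 hs'.1)
    exact ENNReal.add_ne_top.2 ⟨hy_ne s, hG_ne s hs s' hs'⟩
  have hledR : ∀ s ∈ Icc 0 t, ∀ s' ∈ Icc s (s + h),
      yR s' + (L s s').toReal = yR s + (G s s').toReal := by
    intro s hs s' hs'
    have h1 := congrArg ENNReal.toReal (hled s s' hs.1 hs'.1)
    rwa [ENNReal.toReal_add (hy_ne s') (hL_ne s hs s' hs'),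
      ENNReal.toReal_add (hy_ne s) (hG_ne s hs s' hs')] at h1
  -- loss floor, real form
  have hsh : ∀ s : ℝ, s + h ∈ Icc s (s + h) := fun s => ⟨le_add_of_nonneg_right hh.le, le_rfl⟩
  have hlossR : ∀ s ∈ Icc 0 t, c * yR s ≤ c * A + (L s (s + h)).toReal := by
    intro s hs
    have hne : ENNReal.ofReal (c * A) + L s (s + h) ≠ ⊤ :=
      ENNReal.add_ne_top.2 ⟨ENNReal.ofReal_ne_top, hL_ne s hs (s + h) (hsh s)⟩
    have h1 := (ENNReal.toReal_le_toReal
      (ENNReal.mul_ne_top ENNReal.ofReal_ne_top (hy_ne s)) hne).2 (hloss s hs)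
    rwa [ENNReal.toReal_mul, ENNReal.toReal_ofReal hc.le,
      ENNReal.toReal_add ENNReal.ofReal_ne_top (hL_ne s hs (s + h) (hsh s)),
      ENNReal.toReal_ofReal (mul_nonneg hc.le hA)] at h1
  -- Step 1: inside one window the content is controlled by its value at the window start.
  have hwin : ∀ s ∈ Icc 0 t, ∀ r ∈ Icc s (s + h), yR r ≤ yR s + D + η * SR s := by
    intro s hs r hr
    have h1 := hledR s hs r hr
    have h2 := hGR s hs r hr
    have h3 : 0 ≤ (L s r).toReal := ENNReal.toReal_nonneg
    linarith
  have hSR_le : ∀ s ∈ Icc 0 t, SR s ≤ yR s + D + η * SR s := by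
    intro s hs
    have hnn : 0 ≤ yR s + D + η * SR s := by
      have := hyR_nn s; have := hSR_nn s; positivity
    have h1 : S s ≤ ENNReal.ofReal (yR s + D + η * SR s) :=
      iSup₂_le fun r hr => by
        rw [hy_eq r]
        exact ENNReal.ofReal_le_ofReal (hwin s hs r hr)
    exact ENNReal.toReal_le_of_le_ofReal hnn h1
  have hη4 : η ≤ 1 / 4 := hηc.trans (by linarith)
  have hSR_bound : ∀ s ∈ Icc 0 t, SR s ≤ 2 * (yR s + D) := by
    intro s hs
    have h1 := hSR_le s hs
    have h2 : η * SR s ≤ (1 / 4) * SR s := mul_le_mul_of_nonneg_right hη4 (hSR_nn s)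
    have h3 := hyR_nn s
    nlinarith
  -- Step 2: one step of the recursion at a window start `s ∈ [0,t]`.
  have hstep : ∀ s ∈ Icc 0 t, yR (s + h) ≤ (1 - c / 2) * yR s + (c * A + 2 * D) := by
    intro s hs
    have h1 := hledR s hs (s + h) (hsh s)
    have h2 := hGR s hs (s + h) (hsh s)
    have h3 := hlossR s hs
    have h4 := hSR_bound s hs
    have h5 : η * SR s ≤ (c / 4) * SR s := mul_le_mul_of_nonneg_right hηc (hSR_nn s)
    have h6 : (c / 4) * (2 * (yR s + D)) ≤ (c / 2) * yR s + D := by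
      have := hyR_nn s
      nlinarith
    have h7 : (c / 4) * SR s ≤ (c / 4) * (2 * (yR s + D)) :=
      mul_le_mul_of_nonneg_left h4 (by linarith)
    nlinarith
  -- Step 3: induction over the window starts `k·h ≤ t`.
  set K₁ : ℝ := max B (2 * A + 4 * D / c) with hK₁
  have hK₁B : B ≤ K₁ := le_max_left _ _
  have hK₁_abs : c * A + 2 * D ≤ (c / 2) * K₁ := by
    have h1 : (c / 2) * (2 * A + 4 * D / c) = c * A + 2 * D := by
      field_simp
      ring
    have h2 : (c / 2) * (2 * A + 4 * D / c) ≤ (c / 2) * K₁ :=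
      mul_le_mul_of_nonneg_left (le_max_right _ _) (by linarith)
    linarith
  have hK₁_nn : 0 ≤ K₁ := hB.trans hK₁B
  have hgrid : ∀ k : ℕ, (k : ℝ) * h ≤ t → yR ((k : ℝ) * h) ≤ K₁ := by
    intro k
    induction k with
    | zero =>
      intro _
      have h1 : yR 0 ≤ B := ENNReal.toReal_le_of_le_ofReal hB h0
      simpa using h1.trans hK₁B
    | succ k ih =>
      intro hk
      have hk' : ((k : ℝ) + 1) * h ≤ t := by push_cast at hk; exact hk
      have hkh : (k : ℝ) * h ≤ t := by nlinarith
      have hk0 : 0 ≤ (k : ℝ) * h := by positivity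
      have h1 := ih hkh
      have h2 := hstep ((k : ℝ) * h) ⟨hk0, hkh⟩
      have h3 : ((k + 1 : ℕ) : ℝ) * h = (k : ℝ) * h + h := by push_cast; ring
      rw [h3]
      have h4 : (1 - c / 2) * yR ((k : ℝ) * h) ≤ (1 - c / 2) * K₁ :=
        mul_le_mul_of_nonneg_left h1 (by linarith)
      linarith
  -- Step 4: every `s ∈ [0,t]` lies in the window of the grid point `⌊s/h⌋·h ≤ s`.
  intro s hs
  set k : ℕ := ⌊s / h⌋₊ with hk
  have hsk : (k : ℝ) ≤ s / h := Nat.floor_le (div_nonneg hs.1 hh.le)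
  have hsk' : s / h < (k : ℝ) + 1 := Nat.lt_floor_add_one _
  have hk1 : (k : ℝ) * h ≤ s := by rwa [le_div_iff₀ hh] at hsk
  have hk2 : s ≤ (k : ℝ) * h + h := by
    rw [div_lt_iff₀ hh] at hsk'
    linarith
  have hkt : (k : ℝ) * h ≤ t := hk1.trans hs.2
  have hk0 : 0 ≤ (k : ℝ) * h := by positivity
  have h1 : yR s ≤ SR ((k : ℝ) * h) := hyR_le_SR _ s ⟨hk1, hk2⟩
  have h2 := hSR_bound ((k : ℝ) * h) ⟨hk0, hkt⟩
  have h3 := hgrid k hkt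
  rw [hy_eq s]
  apply ENNReal.ofReal_le_ofReal
  calc yR s ≤ 2 * (yR ((k : ℝ) * h) + D) := h1.trans h2
    _ ≤ 2 * (K₁ + D) := by linarith
    _ = quarticCeiling c A D B := by rw [quarticCeiling, hK₁]

/-! ## §4 Composition (sorry-free): the four stubs ⟹ the uniform quartic moment ⟹ the crux BY NAME -/

/-- `y_N(r)`: the expected empirical quartic moment along the flow (the ONE scalar of the line). -/
def quarticMoment (σ : ℝ) (a₀ θ₀ : T3 → ℝ) (u₀ : T3 → V3) (N : ℕ)
    (Φ : HardSphereFlow (Torus.geometry (Fin 3)) (hsDiameter σ N) (N + 1)) (r : ℝ) : ℝ≥0∞ :=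
  ∫⁻ z, ENNReal.ofReal (((N : ℝ) + 1)⁻¹ * ∑ i : Fin (N + 1), ‖(Φ.flow r z i).2‖ ^ 4)
    ∂(localGibbsLaw σ a₀ u₀ θ₀ N Φ)

/-- `Gain_N(s,s′]`: the expected normalised collision sum of the positive parts `(Δ₄)₊/2`. -/
def windowGain (σ : ℝ) (a₀ θ₀ : T3 → ℝ) (u₀ : T3 → V3) (N : ℕ)
    (Φ : HardSphereFlow (Torus.geometry (Fin 3)) (hsDiameter σ N) (N + 1)) (s s' : ℝ) : ℝ≥0∞ :=
  ∫⁻ z, ENNReal.ofReal (((N : ℝ) + 1)⁻¹ *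
      Φ.collisionSum (Set.Ioc s s')
        (fun col => max (‖col.postVel.1‖ ^ 4 + ‖col.postVel.2‖ ^ 4
          - ‖col.preVel.1‖ ^ 4 - ‖col.preVel.2‖ ^ 4) 0 / 2) z)
    ∂(localGibbsLaw σ a₀ u₀ θ₀ N Φ)

/-- `Loss_N(s,s′]`: the expected normalised collision sum of the negative parts `(Δ₄)₋/2`. -/
def windowLoss (σ : ℝ) (a₀ θ₀ : T3 → ℝ) (u₀ : T3 → V3) (N : ℕ)
    (Φ : HardSphereFlow (Torus.geometry (Fin 3)) (hsDiameter σ N) (N + 1)) (s s' : ℝ) : ℝ≥0∞ :=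
  ∫⁻ z, ENNReal.ofReal (((N : ℝ) + 1)⁻¹ *
      Φ.collisionSum (Set.Ioc s s')
        (fun col => max (‖col.preVel.1‖ ^ 4 + ‖col.preVel.2‖ ^ 4
          - ‖col.postVel.1‖ ^ 4 - ‖col.postVel.2‖ ^ 4) 0 / 2) z)
    ∂(localGibbsLaw σ a₀ u₀ θ₀ N Φ)

/-- **The transfer statement C⁺ of the card: an `N`-uniform quartic velocity moment along the true
flow before the first shock** — verbatim the hypothesis of the LANDED docking theorem
`…Theorems.LoschmidtTagging.stub_quarticDocking` (p92098) and the body of ideator-2's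
`QuarticMomentBound`; equivalently the lead's open `IdeatorThreeSketch.stub_quarticInfluence` read on
the `λ_N` side (tagging identity). -/
def QuarticMomentBound : Prop :=
  ∀ (a₀ θ₀ : T3 → ℝ) (u₀ : T3 → V3), Continuous a₀ → Continuous θ₀ → Continuous u₀ →
    (∀ x, 0 < a₀ x) → (∀ x, 0 < θ₀ x) → ∃ σ₀ : ℝ, 0 < σ₀ ∧ ∀ σ : ℝ, 0 < σ → σ < σ₀ →
    ∀ (T : ℝ) (ρ θ : ℝ → T3 → ℝ) (u : ℝ → T3 → V3), IsHardSphereEulerSolution σ T ρ u θ →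
    ∀ Φ : (N : ℕ) → HardSphereFlow (Torus.geometry (Fin 3)) (hsDiameter σ N) (N + 1),
    TendstoHydroFieldsAt (fun N => localGibbsLaw σ a₀ u₀ θ₀ N (Φ N)) Φ ρ u θ 0 →
    ∀ t ∈ Set.Ico 0 T, ∃ C : ℝ, ∃ N₀ : ℕ, ∀ N : ℕ, N₀ ≤ N → ∀ s ∈ Set.Icc 0 t,
      ∫⁻ z, ENNReal.ofReal (((N : ℝ) + 1)⁻¹ * ∑ i : Fin (N + 1), ‖((Φ N).flow s z i).2‖ ^ 4)
        ∂(localGibbsLaw σ a₀ u₀ θ₀ N (Φ N)) ≤ ENNReal.ofReal C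

/-- **THE QUARTIC MAXIMUM PRINCIPLE: L + Q0 + S1 + S2 ⟹ C⁺** (sorry-free).  Take `σ₀` below the three
stubs' thresholds and `1/2`; for `t < T` get `(τ, c, A)` from S1, `D` from S2 at slope `η = c/4`, `B`
from Q0; for `N ≥ max N₀` apply `absorbing_recursion` to `y_N`, `Gain_N`, `Loss_N` with
`h = τ(N+1)^{-1/3}`: `y_N(s) ≤ 2(max B (2A + 4D/c) + D)` for all `s ∈ [0,t]`. -/
theorem quarticMomentBound_of (hL : stub_quarticLedger) (hQ : stub_quarticData)
    (h1 : stub_lossFloor) (h2 : stub_gainCeiling) : QuarticMomentBound := by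
  have hL' : type_of% Holds.stub_quarticLedger := hL
  have hQ' : type_of% Holds.stub_quarticData := hQ
  have h1' : type_of% Holds.stub_lossFloor := h1
  have h2' : type_of% Holds.stub_gainCeiling := h2
  clear hL hQ h1 h2
  intro a₀ θ₀ u₀ ha hθ hu ha0 hθ0
  obtain ⟨σ₁, hσ₁, H1⟩ := h1' a₀ θ₀ u₀ ha hθ hu ha0 hθ0
  obtain ⟨σ₂, hσ₂, H2⟩ := h2' a₀ θ₀ u₀ ha hθ hu ha0 hθ0
  obtain ⟨σ₃, hσ₃, H3⟩ := hQ' a₀ θ₀ u₀ ha hθ hu ha0 hθ0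
  refine ⟨min (min σ₁ σ₂) (min σ₃ (1 / 2)),
    lt_min (lt_min hσ₁ hσ₂) (lt_min hσ₃ (by norm_num)), ?_⟩
  intro σ hσ hσlt T ρ θ u hE Φ h0 t ht
  have hσ₁' : σ < σ₁ := lt_of_lt_of_le hσlt ((min_le_left _ _).trans (min_le_left _ _))
  have hσ₂' : σ < σ₂ := lt_of_lt_of_le hσlt ((min_le_left _ _).trans (min_le_right _ _))
  have hσ₃' : σ < σ₃ := lt_of_lt_of_le hσlt ((min_le_right _ _).trans (min_le_left _ _))
  have hσh : σ < 1 / 2 := lt_of_lt_of_le hσlt ((min_le_right _ _).trans (min_le_right _ _))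
  obtain ⟨τ, hτ, c, hc, hc1, A, hA, N₁, HS1⟩ := H1 σ hσ hσ₁' T ρ θ u hE Φ h0 t ht
  obtain ⟨D, hD, N₂, HS2⟩ := H2 σ hσ hσ₂' T ρ θ u hE Φ h0 t ht τ hτ (c / 4) (by positivity)
  obtain ⟨B, hB, N₃, HQ⟩ := H3 σ hσ hσ₃' Φ
  refine ⟨quarticCeiling c A D B, max N₁ (max N₂ N₃), fun N hN s hs => ?_⟩
  have hN₁ : N₁ ≤ N := le_trans (le_max_left _ _) hN
  have hN₂ : N₂ ≤ N := le_trans ((le_max_left _ _).trans (le_max_right _ _)) hN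
  have hN₃ : N₃ ≤ N := le_trans ((le_max_right _ _).trans (le_max_right _ _)) hN
  obtain ⟨hQ0, B', hB'⟩ := HQ N hN₃
  have hh : 0 < τ * ((N : ℝ) + 1) ^ (-(1 / 3 : ℝ)) := by positivity
  exact absorbing_recursion (y := quarticMoment σ a₀ θ₀ u₀ N (Φ N))
    (G := windowGain σ a₀ θ₀ u₀ N (Φ N)) (L := windowLoss σ a₀ θ₀ u₀ N (Φ N)) (t := t)
    hh hc hc1 hA hD (by positivity) le_rfl hB hB' hQ0
    (fun s₁ s₂ hs₁ hs₁₂ => hL' a₀ θ₀ u₀ σ hσ hσh N (Φ N) s₁ s₂ hs₁ hs₁₂)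
    (HS1 N hN₁) (HS2 N hN₂) s hs

/-- **THE SKELETON THEOREM** for the item's primary decl (`WarmColdDichotomy.EnergyCurrentTails`,
definitionally the same `Prop` as the `OneFlightGossipEngine` copy): the four stubs imply the crux BY
NAME, through C⁺ and the landed quartic docking (Chebyshev). -/
theorem EnergyCurrentTails_of (hL : stub_quarticLedger) (hQ : stub_quarticData)
    (h1 : stub_lossFloor) (h2 : stub_gainCeiling) :
    Summit.AtomisticToContinuum.HydrodynamicLimit.Theses.WarmColdDichotomy.EnergyCurrentTails := by
  show Summit.AtomisticToContinuum.HydrodynamicLimit.Theses.OneFlightGossipEngine.EnergyCurrentTails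
  exact Summit.AtomisticToContinuum.HydrodynamicLimit.Theorems.LoschmidtTagging.stub_quarticDocking
    (quarticMomentBound_of hL hQ h1 h2)

/-- The same skeleton theorem for the route copy `OneFlightGossipEngine.EnergyCurrentTails`
(route-AtomisticToContinuum-OneFlightGossipEngine, the payload route of this crux-plan). -/
theorem EnergyCurrentTails_of_oneFlight (hL : stub_quarticLedger) (hQ : stub_quarticData)
    (h1 : stub_lossFloor) (h2 : stub_gainCeiling) :
    Summit.AtomisticToContinuum.HydrodynamicLimit.Theses.OneFlightGossipEngine.EnergyCurrentTails :=
  Summit.AtomisticToContinuum.HydrodynamicLimit.Theorems.LoschmidtTagging.stub_quarticDocking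
    (quarticMomentBound_of hL hQ h1 h2)

/-- **The line's closing theorem, modulo the four registered stubs** (sorry-free once they are):
the declaration the gate probes. -/
theorem EnergyCurrentTails_proof :
    Summit.AtomisticToContinuum.HydrodynamicLimit.Theses.WarmColdDichotomy.EnergyCurrentTails :=
  EnergyCurrentTails_of Holds.stub_quarticLedger Holds.stub_quarticData Holds.stub_lossFloor
    Holds.stub_gainCeiling

/-! ## §5 Certificates (sorry-free; lead 1, cycle 2): the logical position of the two open stubs

* `lossFloor_of_quarticMomentBound` — **S1 ⟸ C⁺**: the loss floor is implied by the very quartic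
  moment bound the line proves (`A := C`, `c := 1`, `τ := 1`, `Loss ≥ 0`).  Consequences: S1 cannot
  be refuted without refuting C⁺ (and C⁺ is implied by every Gaussian-envelope statement of the
  sibling lines); the line's burden BEYOND C⁺ is exactly S2 (an `N`-uniform energy-weighted
  collision-flux ceiling under the evolved law); and `L ∧ Q0 ∧ S1 ∧ S2 ⟹ C⁺ ⟹ S1`.
* `quarticMoment_rung0_le` — at global equilibrium (`u₀ = 0`, constant `a, θ̄`) the quartic moment is
  CONSTANT in `s` and `N`: `y_N(s) = E‖w‖⁴`, `w ∼ N(0, θ̄I₃)` (stationarity of the homogeneous Gibbs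
  law + one-body disintegration), so S1 holds there with `A = E‖w‖⁴` (`lossFloor_rung0`).
* `gainCeiling_rung0_body` — the literal body of S2 at constant profiles (any drift), from the
  landed certificate `stub_gainCeilingRung0` (p98294).
* `TailLossFloor` + `lossFloor_of_tailLossFloor` — **S1 ⟸ H_L** (`A := Λ²`): the intended
  sufficient condition for S1 (energetic spheres dissipate a fraction of their quartic content per
  window), typed as the attackable dynamical target behind S1 (H_L is NOT implied by C⁺).
-/

/-- **S1 ⟸ C⁺.**  The uniform quartic moment bound implies the loss floor, trivially: take the
window `τ = 1`, the fraction `c = 1` and the level `A = max C 0`; then `y_N(s) ≤ A ≤ A + Loss`. -/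
theorem lossFloor_of_quarticMomentBound (hC : QuarticMomentBound) : stub_lossFloor := by
  show type_of% Holds.stub_lossFloor
  intro a₀ θ₀ u₀ ha hθ hu ha0 hθ0
  obtain ⟨σ₀, hσ₀, H⟩ := hC a₀ θ₀ u₀ ha hθ hu ha0 hθ0
  refine ⟨σ₀, hσ₀, fun σ hσ hσlt T ρ θ u hE Φ h0 t ht => ?_⟩
  obtain ⟨C, N₀, HN⟩ := H σ hσ hσlt T ρ θ u hE Φ h0 t ht
  refine ⟨1, one_pos, 1, one_pos, le_rfl, max C 0, le_max_right _ _, N₀, fun N hN s hs => ?_⟩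
  rw [ENNReal.ofReal_one, one_mul, one_mul]
  calc quarticMoment σ a₀ θ₀ u₀ N (Φ N) s ≤ ENNReal.ofReal C := HN N hN s hs
    _ ≤ ENNReal.ofReal (max C 0) := ENNReal.ofReal_le_ofReal (le_max_left _ _)
    _ ≤ _ := le_self_add

/-- **The TAIL LOSS FLOOR `H_L` — the intended sufficient condition for S1** (the card's S1 in tail
form; the census line's F3 in quartic currency; typed here as a target for the disprover and the
planner, NOT registered as a stub).  In the frame of the crux: for every `t < T` there are a window
`τ > 0`, a fraction `c ∈ (0,1]`, a level `Λ ≥ 0` and `N₀` such that for `N ≥ N₀`, `s ∈ [0,t]`: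
`c · E[(N+1)⁻¹ Σᵢ ‖vᵢ(s)‖⁴ 𝟙{Λ < ‖vᵢ(s)‖²}] ≤ Loss_N(s, s + τ(N+1)^{-1/3}]` — energetic spheres
dissipate the fraction `c` of their quartic content within one window.  Unlike S1 it is NOT implied
by C⁺ (it is a genuine dissipation statement, non-trivial already at rung 0, where it needs a LOWER
bound on the collision flux of fast spheres — not in the tree). -/
def TailLossFloor : Prop :=
    ∀ (a₀ θ₀ : T3 → ℝ) (u₀ : T3 → V3), Continuous a₀ → Continuous θ₀ → Continuous u₀ →
      (∀ x, 0 < a₀ x) → (∀ x, 0 < θ₀ x) →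
      ∃ σ₀ : ℝ, 0 < σ₀ ∧ ∀ σ : ℝ, 0 < σ → σ < σ₀ →
        ∀ (T : ℝ) (ρ θ : ℝ → T3 → ℝ) (u : ℝ → T3 → V3), IsHardSphereEulerSolution σ T ρ u θ →
          ∀ Φ : (N : ℕ) → HardSphereFlow (Torus.geometry (Fin 3)) (hsDiameter σ N) (N + 1),
            TendstoHydroFieldsAt (fun N => localGibbsLaw σ a₀ u₀ θ₀ N (Φ N)) Φ ρ u θ 0 →
              ∀ t ∈ Set.Ico 0 T, ∃ τ : ℝ, 0 < τ ∧ ∃ c : ℝ, 0 < c ∧ c ≤ 1 ∧ ∃ Λ : ℝ, 0 ≤ Λ ∧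
                ∃ N₀ : ℕ, ∀ N : ℕ, N₀ ≤ N → ∀ s ∈ Set.Icc 0 t,
                  ENNReal.ofReal c *
                      (∫⁻ z, ENNReal.ofReal (((N : ℝ) + 1)⁻¹ *
                          ∑ i : Fin (N + 1), Set.indicator {v : V3 | Λ < ‖v‖ ^ 2} (fun v => ‖v‖ ^ 4)
                            (((Φ N).flow s z i).2))
                        ∂(localGibbsLaw σ a₀ u₀ θ₀ N (Φ N)))
                    ≤ windowLoss σ a₀ θ₀ u₀ N (Φ N) s (s + τ * ((N : ℝ) + 1) ^ (-(1 / 3 : ℝ)))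

/-- The elementary level split behind `lossFloor_of_tailLossFloor`: `‖v‖⁴ ≤ Λ² + ‖v‖⁴𝟙{Λ < ‖v‖²}`
(any real `Λ`). [folklore] -/
theorem pow_four_le_sq_add_indicator (Λ : ℝ) (v : V3) :
    ‖v‖ ^ 4 ≤ Λ ^ 2 + Set.indicator {v : V3 | Λ < ‖v‖ ^ 2} (fun v => ‖v‖ ^ 4) v := by
  by_cases hv : Λ < ‖v‖ ^ 2
  · rw [Set.indicator_of_mem (show v ∈ {v : V3 | Λ < ‖v‖ ^ 2} from hv)]
    nlinarith [sq_nonneg Λ]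
  · rw [Set.indicator_of_notMem (show v ∉ {v : V3 | Λ < ‖v‖ ^ 2} from hv), add_zero]
    have h1 : ‖v‖ ^ 2 ≤ Λ := not_lt.1 hv
    have h2 : 0 ≤ ‖v‖ ^ 2 := sq_nonneg _
    calc ‖v‖ ^ 4 = (‖v‖ ^ 2) ^ 2 := by ring
      _ ≤ Λ ^ 2 := pow_le_pow_left₀ h2 h1 2

/-- **S1 ⟸ H_L.**  The tail loss floor implies the registered loss floor with `A = Λ²` (same `τ`,
`c`): `y_N(s) ≤ Λ² + E[(N+1)⁻¹Σ‖vᵢ‖⁴𝟙{Λ<‖vᵢ‖²}]` (`λ_N` is a probability measure for `σ ≤ 1/2`,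
so shrink `σ₀` to `≤ 1/2`). -/
theorem lossFloor_of_tailLossFloor (hL : TailLossFloor) : stub_lossFloor := by
  show type_of% Holds.stub_lossFloor
  intro a₀ θ₀ u₀ ha hθ hu ha0 hθ0
  obtain ⟨σ₀, hσ₀, H⟩ := hL a₀ θ₀ u₀ ha hθ hu ha0 hθ0
  refine ⟨min σ₀ (1 / 2), lt_min hσ₀ (by norm_num), fun σ hσ hσlt T ρ θ u hE Φ h0 t ht => ?_⟩
  have hσ₀' : σ < σ₀ := lt_of_lt_of_le hσlt (min_le_left _ _)
  have hσ2 : σ ≤ 1 / 2 := (lt_of_lt_of_le hσlt (min_le_right _ _)).le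
  obtain ⟨τ, hτ, c, hc, hc1, Λ, _hΛ, N₀, HN⟩ := H σ hσ hσ₀' T ρ θ u hE Φ h0 t ht
  refine ⟨τ, hτ, c, hc, hc1, Λ ^ 2, sq_nonneg _, N₀, fun N hN s hs => ?_⟩
  haveI := isProbabilityMeasure_localGibbsLaw ha hθ hu ha0 hθ0 hσ2 N (Φ N)
  have hkey := HN N hN s hs
  -- the tail integrand and the level split, pointwise
  set tail : Config (N + 1) (Fin 3) T3 → ℝ := fun z => ((N : ℝ) + 1)⁻¹ *
    ∑ i : Fin (N + 1), Set.indicator {v : V3 | Λ < ‖v‖ ^ 2} (fun v => ‖v‖ ^ 4)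
      (((Φ N).flow s z i).2) with htail
  have htail0 : ∀ z, 0 ≤ tail z := fun z => by
    rw [htail]
    exact mul_nonneg (by positivity) (Finset.sum_nonneg fun i _ =>
      Set.indicator_nonneg (fun v _ => by positivity) _)
  have hsplit : ∀ z, ((N : ℝ) + 1)⁻¹ * ∑ i : Fin (N + 1), ‖((Φ N).flow s z i).2‖ ^ 4 ≤
      Λ ^ 2 + tail z := by
    intro z
    have hN1 : (0 : ℝ) < (N : ℝ) + 1 := by positivity
    have hsum : ∑ i : Fin (N + 1), ‖((Φ N).flow s z i).2‖ ^ 4 ≤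
        ∑ i : Fin (N + 1), (Λ ^ 2 + Set.indicator {v : V3 | Λ < ‖v‖ ^ 2} (fun v => ‖v‖ ^ 4)
          (((Φ N).flow s z i).2)) :=
      Finset.sum_le_sum fun i _ => pow_four_le_sq_add_indicator Λ _
    rw [Finset.sum_add_distrib, Finset.sum_const, Finset.card_univ, Fintype.card_fin,
      nsmul_eq_mul] at hsum
    rw [htail]
    have e : ((N : ℝ) + 1)⁻¹ * (((N + 1 : ℕ) : ℝ) * Λ ^ 2) = Λ ^ 2 := by
      push_cast; field_simp
    calc ((N : ℝ) + 1)⁻¹ * ∑ i : Fin (N + 1), ‖((Φ N).flow s z i).2‖ ^ 4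
        ≤ ((N : ℝ) + 1)⁻¹ * (((N + 1 : ℕ) : ℝ) * Λ ^ 2 + ∑ i : Fin (N + 1),
            Set.indicator {v : V3 | Λ < ‖v‖ ^ 2} (fun v => ‖v‖ ^ 4) (((Φ N).flow s z i).2)) :=
          mul_le_mul_of_nonneg_left hsum (inv_nonneg.2 hN1.le)
      _ = Λ ^ 2 + ((N : ℝ) + 1)⁻¹ * ∑ i : Fin (N + 1),
            Set.indicator {v : V3 | Λ < ‖v‖ ^ 2} (fun v => ‖v‖ ^ 4) (((Φ N).flow s z i).2) := by
          rw [mul_add, e]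
  -- integrate: `y(s) ≤ Λ² + ∫ tail`
  have hmeas : Measurable fun z => ENNReal.ofReal (tail z) := by
    rw [htail]
    refine ((Finset.measurable_sum _ fun i _ => ?_).const_mul _).ennreal_ofReal
    exact ((measurable_norm.pow_const 4).indicator
      (measurableSet_lt measurable_const (measurable_norm.pow_const 2))).comp
      (measurable_snd.comp ((measurable_pi_apply i).comp ((Φ N).measurable_flow s)))
  have hy : quarticMoment σ a₀ θ₀ u₀ N (Φ N) s ≤
      ENNReal.ofReal (Λ ^ 2) + ∫⁻ z, ENNReal.ofReal (tail z) ∂(localGibbsLaw σ a₀ u₀ θ₀ N (Φ N)) := by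
    calc quarticMoment σ a₀ θ₀ u₀ N (Φ N) s
        ≤ ∫⁻ z, (ENNReal.ofReal (Λ ^ 2) + ENNReal.ofReal (tail z))
            ∂(localGibbsLaw σ a₀ u₀ θ₀ N (Φ N)) := by
          refine lintegral_mono fun z => ?_
          rw [← ENNReal.ofReal_add (sq_nonneg _) (htail0 z)]
          exact ENNReal.ofReal_le_ofReal (hsplit z)
      _ = ENNReal.ofReal (Λ ^ 2) + ∫⁻ z, ENNReal.ofReal (tail z)
            ∂(localGibbsLaw σ a₀ u₀ θ₀ N (Φ N)) := by
          rw [lintegral_add_right _ hmeas, lintegral_const, measure_univ, mul_one]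
  calc ENNReal.ofReal c * quarticMoment σ a₀ θ₀ u₀ N (Φ N) s
      ≤ ENNReal.ofReal c * (ENNReal.ofReal (Λ ^ 2) +
          ∫⁻ z, ENNReal.ofReal (tail z) ∂(localGibbsLaw σ a₀ u₀ θ₀ N (Φ N))) := by gcongr
    _ = ENNReal.ofReal (c * Λ ^ 2) + ENNReal.ofReal c *
          ∫⁻ z, ENNReal.ofReal (tail z) ∂(localGibbsLaw σ a₀ u₀ θ₀ N (Φ N)) := by
        rw [mul_add, ENNReal.ofReal_mul hc.le]
    _ ≤ ENNReal.ofReal (c * Λ ^ 2) +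
          windowLoss σ a₀ θ₀ u₀ N (Φ N) s (s + τ * ((N : ℝ) + 1) ^ (-(1 / 3 : ℝ))) := by
        gcongr

/-- **The quartic moment at rung 0 (zero drift).**  Under the homogeneous Gibbs law
`G_N = localGibbsLaw σ a 0 θ̄` (`0 < σ < 1/2`, `a, θ̄ > 0`), for EVERY flow, every `N` and every time
`s`:  `y_N(s) = ∫ ‖w‖⁴ dN(0, θ̄I₃)(w)` — stationarity (`lintegral_comp_flow_localGibbsLaw_const`) and
the one-body disintegration (`lintegral_vel_localGibbsLaw_const`). [folklore] -/
theorem quarticMoment_rung0_eq {σ a θb : ℝ} (hσ : 0 < σ) (hσ2 : σ < 1 / 2) (ha : 0 < a)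
    (hθ : 0 < θb) (N : ℕ) (Φ : HardSphereFlow (Torus.geometry (Fin 3)) (hsDiameter σ N) (N + 1))
    (s : ℝ) :
    quarticMoment σ (fun _ => a) (fun _ => θb) (fun _ => 0) N Φ s =
      ∫⁻ w, ENNReal.ofReal (‖w‖ ^ 4) ∂(gaussMeasure (0 : V3) θb) := by
  have _ := hσ
  have hg : Measurable fun w : V3 => ENNReal.ofReal (‖w‖ ^ 4) :=
    (measurable_norm.pow_const 4).ennreal_ofReal
  have hvel : ∀ i : Fin (N + 1), Measurable fun w : Config (N + 1) (Fin 3) T3 =>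
      ENNReal.ofReal (‖(w i).2‖ ^ 4) := fun i =>
    hg.comp (measurable_snd.comp (measurable_pi_apply i))
  -- the static integrand and its pointwise product form
  set g : Config (N + 1) (Fin 3) T3 → ℝ≥0∞ := fun w =>
    ENNReal.ofReal (((N : ℝ) + 1)⁻¹ * ∑ i : Fin (N + 1), ‖(w i).2‖ ^ 4) with hgdef
  have hpt : ∀ w : Config (N + 1) (Fin 3) T3, g w =
      ENNReal.ofReal (((N : ℝ) + 1)⁻¹) * ∑ i : Fin (N + 1), ENNReal.ofReal (‖(w i).2‖ ^ 4) := by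
    intro w
    rw [hgdef]
    dsimp only
    rw [ENNReal.ofReal_mul (by positivity), ENNReal.ofReal_sum_of_nonneg fun i _ => by positivity]
  have hgm : Measurable g :=
    ((Finset.measurable_sum _ fun i _ => (measurable_norm.pow_const 4).comp
      (measurable_snd.comp (measurable_pi_apply i))).const_mul _).ennreal_ofReal
  have hN : ENNReal.ofReal (((N : ℝ) + 1)⁻¹) * ((N + 1 : ℕ) : ℝ≥0∞) = 1 := by
    rw [ENNReal.ofReal_inv_of_pos (by positivity)]
    have : ENNReal.ofReal ((N : ℝ) + 1) = ((N + 1 : ℕ) : ℝ≥0∞) := by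
      rw [show ((N : ℝ) + 1) = ((N + 1 : ℕ) : ℝ) by push_cast; ring, ENNReal.ofReal_natCast]
    rw [this]
    exact ENNReal.inv_mul_cancel (by simp) (ENNReal.natCast_ne_top _)
  calc quarticMoment σ (fun _ => a) (fun _ => θb) (fun _ => 0) N Φ s
      = ∫⁻ z, g (Φ.flow s z) ∂(localGibbsLaw σ (fun _ => a) (fun _ => 0) (fun _ => θb) N Φ) := rfl
    _ = ∫⁻ z, g z ∂(localGibbsLaw σ (fun _ => a) (fun _ => 0) (fun _ => θb) N Φ) :=
        Summit.AtomisticToContinuum.HydrodynamicLimit.Theorems.lintegral_comp_flow_localGibbsLaw_const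
          σ a θb 0 N Φ s hgm
    _ = ∫⁻ z, ENNReal.ofReal (((N : ℝ) + 1)⁻¹) * ∑ i : Fin (N + 1), ENNReal.ofReal (‖(z i).2‖ ^ 4)
          ∂(localGibbsLaw σ (fun _ => a) (fun _ => 0) (fun _ => θb) N Φ) :=
        lintegral_congr fun z => hpt z
    _ = ENNReal.ofReal (((N : ℝ) + 1)⁻¹) *
          ∑ i : Fin (N + 1), ∫⁻ z, ENNReal.ofReal (‖(z i).2‖ ^ 4)
            ∂(localGibbsLaw σ (fun _ => a) (fun _ => 0) (fun _ => θb) N Φ) := by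
        rw [lintegral_const_mul _ (Finset.measurable_sum _ fun i _ => hvel i),
          lintegral_finsetSum _ fun i _ => hvel i]
    _ = ENNReal.ofReal (((N : ℝ) + 1)⁻¹) *
          ∑ _i : Fin (N + 1), ∫⁻ w, ENNReal.ofReal (‖w‖ ^ 4) ∂(gaussMeasure (0 : V3) θb) := by
        congr 1
        refine Finset.sum_congr rfl fun i _ => ?_
        exact Summit.AtomisticToContinuum.HydrodynamicLimit.Theorems.LoschmidtTagging.lintegral_vel_localGibbsLaw_const
          hσ2.le ha hθ N Φ i hg
    _ = ∫⁻ w, ENNReal.ofReal (‖w‖ ^ 4) ∂(gaussMeasure (0 : V3) θb) := by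
        rw [Finset.sum_const, Finset.card_univ, Fintype.card_fin, nsmul_eq_mul, ← mul_assoc, hN,
          one_mul]

/-- **Rung 0 of the quartic moment bound** (zero drift): `y_N(s) ≤ E‖w‖⁴ < ∞` for all `N`, `s`,
every flow — the `k = 0` rung of C⁺ in the line's own currency (no `N₀`, no horizon). [folklore] -/
theorem quarticMoment_rung0_le {σ a θb : ℝ} (hσ : 0 < σ) (hσ2 : σ < 1 / 2) (ha : 0 < a)
    (hθ : 0 < θb) (Φ : (N : ℕ) → HardSphereFlow (Torus.geometry (Fin 3)) (hsDiameter σ N) (N + 1)) :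
    ∃ A : ℝ, 0 ≤ A ∧ ∀ (N : ℕ) (s : ℝ),
      quarticMoment σ (fun _ => a) (fun _ => θb) (fun _ => 0) N (Φ N) s ≤ ENNReal.ofReal A := by
  set K : ℝ≥0∞ := ∫⁻ w, ENNReal.ofReal (‖w‖ ^ 4) ∂(gaussMeasure (0 : V3) θb) with hK
  have hKtop : K ≠ ⊤ :=
    (Summit.AtomisticToContinuum.HydrodynamicLimit.Theorems.LoschmidtTagging.lintegral_norm_pow_four_lt_top
      (0 : V3) θb).ne
  refine ⟨K.toReal, ENNReal.toReal_nonneg, fun N s => ?_⟩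
  rw [quarticMoment_rung0_eq hσ hσ2 ha hθ N (Φ N) s, ENNReal.ofReal_toReal hKtop]

/-- **S1 at rung 0 (zero drift)**: at global equilibrium the loss floor holds with `c = 1`,
`A = E‖w‖⁴` and any window, for ALL `N` and ALL window starts `s` (the loss is `≥ 0` and the
quartic moment never exceeds its equilibrium value). [folklore] -/
theorem lossFloor_rung0 {σ a θb : ℝ} (hσ : 0 < σ) (hσ2 : σ < 1 / 2) (ha : 0 < a) (hθ : 0 < θb)
    (Φ : (N : ℕ) → HardSphereFlow (Torus.geometry (Fin 3)) (hsDiameter σ N) (N + 1)) :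
    ∃ A : ℝ, 0 ≤ A ∧ ∀ (N : ℕ) (s s' : ℝ),
      ENNReal.ofReal 1 * quarticMoment σ (fun _ => a) (fun _ => θb) (fun _ => 0) N (Φ N) s ≤
        ENNReal.ofReal (1 * A) + windowLoss σ (fun _ => a) (fun _ => θb) (fun _ => 0) N (Φ N) s s' := by
  obtain ⟨A, hA, H⟩ := quarticMoment_rung0_le hσ hσ2 ha hθ Φ
  refine ⟨A, hA, fun N s s' => ?_⟩
  rw [ENNReal.ofReal_one, one_mul, one_mul]
  exact (H N s).trans le_self_add

/-- **The body of stub S2 `stub_gainCeiling` at constant profiles** (`σ₀` = the small reduced density;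
the Euler solution, the LLN hypothesis, `t < T` and the slope `η > 0` are unused; `N₀ = 1`):
`Gain_N(s,s′] ≤ D + η · sup_{r ∈ [s,s′]} y_N(r)` with the `D` of `stub_gainCeilingRung0`. [folklore] -/
theorem gainCeiling_rung0_body (a θb : ℝ) (u : V3) (ha : 0 < a) (hθ : 0 < θb) :
    ∃ σ₀ : ℝ, 0 < σ₀ ∧ ∀ σ : ℝ, 0 < σ → σ < σ₀ →
      ∀ (T : ℝ) (ρ θ : ℝ → T3 → ℝ) (uE : ℝ → T3 → V3), IsHardSphereEulerSolution σ T ρ uE θ →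
        ∀ Φ : (N : ℕ) → HardSphereFlow (Torus.geometry (Fin 3)) (hsDiameter σ N) (N + 1),
          TendstoHydroFieldsAt
              (fun N => localGibbsLaw σ (fun _ => a) (fun _ => u) (fun _ => θb) N (Φ N)) Φ ρ uE θ 0 →
            ∀ t ∈ Set.Ico 0 T, ∀ τ : ℝ, 0 < τ → ∀ η : ℝ, 0 < η → ∃ D : ℝ, 0 ≤ D ∧
              ∃ N₀ : ℕ, ∀ N : ℕ, N₀ ≤ N → ∀ s ∈ Set.Icc 0 t,
                ∀ s' ∈ Set.Icc s (s + τ * ((N : ℝ) + 1) ^ (-(1 / 3 : ℝ))),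
                  (∫⁻ z, ENNReal.ofReal (((N : ℝ) + 1)⁻¹ *
                      (Φ N).collisionSum (Set.Ioc s s')
                        (fun col => max (‖col.postVel.1‖ ^ 4 + ‖col.postVel.2‖ ^ 4
                          - ‖col.preVel.1‖ ^ 4 - ‖col.preVel.2‖ ^ 4) 0 / 2) z)
                    ∂(localGibbsLaw σ (fun _ => a) (fun _ => u) (fun _ => θb) N (Φ N)))
                  ≤ ENNReal.ofReal D + ENNReal.ofReal η *
                      ⨆ r ∈ Set.Icc s s',
                        (∫⁻ z, ENNReal.ofReal (((N : ℝ) + 1)⁻¹ *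
                            ∑ i : Fin (N + 1), ‖((Φ N).flow r z i).2‖ ^ 4)
                          ∂(localGibbsLaw σ (fun _ => a) (fun _ => u) (fun _ => θb) N (Φ N))) := by
  obtain ⟨σ₀, hσ₀, hmain⟩ :=
    Summit.AtomisticToContinuum.HydrodynamicLimit.Theorems.QuarticSchurLedger.stub_gainCeilingRung0
      a θb u ha hθ
  refine ⟨σ₀, hσ₀, fun σ hσ hσlt _ _ _ _ _ Φ _ t _ τ hτ η _ => ?_⟩
  obtain ⟨D, hD, N₀, hbound⟩ := hmain σ hσ hσlt Φ τ hτ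
  exact ⟨D, hD, N₀, fun N hN s _ s' hs' => (hbound N hN s s' hs'.2).trans le_self_add⟩

end Summit.AtomisticToContinuum.HydrodynamicLimit.Cruxes.EnergyCurrentTails.QuarticSchurLedger

end
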